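import Summits.AnomalousDissipation.AnomalousDissipation.Theorems.SolenoidalFractalHomogenisationLagrangianStepCellClauseCuts
import Summits.AnomalousDissipation.AnomalousDissipation.Theorems.SolenoidalFractalHomogenisationLagrangianStepOneLevelGlueLower
import HarnessLib

/-!
# K1L `LagrangianRenormalisationStep` (stmt-AnomalousDissipation-24912) — `IntervalWindowClause` for the ν-DEPENDENT shape family (D24-1 (4)); §6–§7: SECTORIAL odd guard (D24-3 typing of record)
# planner ad-ideate-p4 g9, lens «control» (controlling quantity = Thompson part metric to a fixed shape); crux workfile, NOT a registered line.

Tenure D24-1 frees the one-level shape map of `stub_cellLawV` to a family `Φ : ℝ → (Visc4 → Visc4)` (level `i` is renormalised through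
`Φ (E.cellVisc i)`; p1's `shapeSeqF` / `chainTensorF` / `SlowVectorClause(NoEx)F`, copied VERBATIM in §3/§4 until `…OneLevelDefsFamily` lands) and asks
(item (4)) for the ROBUST replacement candidate of `WindowClause`: the S⋆-CENTRED ORDER-INTERVAL window of crux idea `fixed-shape-part-metric`
(p4 g4; evidence #27/#28), typed for the family, together with the two facts its consumers need.  This file delivers, farm-checked:

* §1 the transverse Loewner order `TransLE`, the order interval `InInterval S⋆ λ S :⇔ S⋆/λ ≼ S ≼ λS⋆` (closed part-metric ball of radius `log λ`),
  monotonicity in `λ`, and the two CURRENCY CONVERSIONS `InInterval.nearIso` (interval ⇒ `NearIso (slo/λ) (shi·λ)`) and `inInterval_of_nearIso`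
  (`NearIso a b` ⇒ interval of aspect `λ ≥ max (shi/a, b/slo)`), so every downstream clause TEXT stays in `NearIso` currency;
* §2 `IntervalWindowClause Φν S⋆ slo shi λ₀ Λ β μ`: the guarded intervals `{OddSmall β} ∩ [[S⋆/λ, λS⋆]]`, `λ ∈ [λ₀, Λ]`, are mapped by `Φν` into the
  interval of aspect `μ·λ` — WITH A CENTRE DEFECT `μ ≥ 1` (`μ = 1` is g4's exact clause; see DESIGN FINDING below for why the family needs `μ`);
* §3 CONSUMER FACT 1 (chain, replaces `shapeSeq_window`/`hwinT` of `chainLower_of_pieces` p629119): along `shapeSeqF` the aspect runs as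
  `aspF d = λ₀·∏_{i<d} μ(cellVisc (j−i))`; under the tail bound `aspF ≤ Λc` every chain shape AND its `Φ`-image is `OddSmall β ∧ NearIso lo hi`
  (`lo·Λc ≤ slo`, `shi·Λc ≤ hi`) and `NearIso (chainTensorF E Φ j m) (kbar m·lo) (kbar m·hi)` (`chainTensorF_nearIso`) — the `𝔸`-window conjunct of
  `ChainLower E` verbatim; the tail bound is the typed SUPPORT statement `TailDefectBound μ λ₀ Λc` (S-sized: `μ ν ≤ exp(Dν^σ)` + the template's
  super-geometric `cellVisc` decay), consumed by the glue AFTER `E` is fixed by enlarging `mstar`;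
* §4 CONSUMER FACT 2 (F2, replaces `nearIso_effTensor` of p629134): `nearIso_effTensorI` — ellipticity of the effective tensor
  `(1/n²)•(𝔸 + (c/ν)•Φν((1/ν)•𝔸))` from the interval clause, `exists_effective_singleModeI` (Lions) and the family adapter
  `slowVectorClauseF_of_noExF_interval : (∀ ν, IntervalWindowClause (Φ ν) …) → SlowVectorClauseNoExF … → SlowVectorClauseF …` under the explicit
  COMPATIBILITY inequalities `ΛV·shi ≤ Λ'·lo`, `ΛV·hi ≤ Λ'·slo`, `Λ' ∈ [λ₀, Λ]` (the (V)-window must sit inside ONE clause interval);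
* §5 the package `IntervalWindowFamily` (clause ∀ν + defect facts + the seven bookkeeping inequalities), CANDIDATE v22⋆ stub texts `stub_cellLawW_I`
  (window half of `stub_cellLawV` over the package) and the WINDOW-AGNOSTIC `stub_oneLevelL_I` (no window-clause binder at all; the two facts about
  `Φ (cellVisc (m+1)) S` it needs become hypotheses on `S` — CONSENT ASK to the lead; a checked `example` shows it implies the v22 text under ANY
  `∀ ν, WindowClause (Φ ν) …`), and the PROVED re-plumbed glue `chainLower_of_pieces_I` (= p629119's `chainLower_of_pieces` through the package:
  `mstar ↦ max mstar m₁`, existence by `existsL_tensor`);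
* §6 AMENDMENT 1 (answer to p5 §7 (b), the odd-part catch for ANY window with the same absolute `β` in and out): the SECTORIAL odd guard
  `OddSectorial S τ` (Kato sector: `(odd bsymb)² ≤ τ²·σ(k,p)·σ(k,q)`), scale-invariant, closed under positive sums / `renormStep`, EXACTLY preserved
  by block inversion (`sector_inv`, the finite-dimensional certificate that the degree-(−1) response does not amplify it), convertible both ways
  against `NearIso`; the clause `SectorialWindowClause Φ lo hi Λ τlo τhi` (= `WindowClause` with `OddSmall ↦ OddSectorial`, `∀ τ ∈ [τlo, τhi]`), its
  two consumer facts (`chainTensorF_sectorial`, `nearIso_effTensorS` / `slowVectorClauseF_of_noExF_sectorial`), candidate text `stub_cellLawW_S`, and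
  the PROVED glue `chainLower_of_pieces_S` with the UNCHANGED window-agnostic `stub_oneLevelL_I` ((V)/(T)/(L) texts byte-identical: absolute
  `OddSmall … β` downstream, `τc·hi ≤ β`, `β·Λ/lo ∈ [τlo, τhi]`).  FINDING F-p4g9-2: p5's class condition `a⋆(W)·γ_W < 1` (absolute guard) relaxes
  to `sup_window γ^{sect} < 1`, which on the isotropic ray is exactly `γ_W < 1` — every isotropic word (`OddChannelAMGM`).
* §7 AMENDMENT 2 (tenure D24-3: «v2 window typing of record = p4 defect family + SECTORIAL odd guard + p5 W5 + `stub_oneLevelL_I`»): the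
  consumer facts for the S⋆-centred sectorial clause `SectorialIntervalWindowClause` (chain `chainTensorF_nearIsoS` / `chainImage_nearIsoS`, F2
  `nearIso_effTensorIS` / `exists_effective_singleModeIS` / `slowVectorClauseF_of_noExF_intervalS`), the package `SectorialIntervalWindowFamily`
  (eleven interval conjuncts + four sector bookkeeping facts), candidate text `stub_cellLawW_IS`, the PROVED glue `chainLower_of_pieces_IS`
  (one-level step = the unchanged `stub_oneLevelL_I`), the `μ ≡ 1` discharge `tailDefectBound_one`, and p5's W5 in sectorial currency
  `SectorialOddChannelBound` with `sectorialIntervalWindowClause_of_channelBound` / `sector_fix_of_gain_lt_one` (odd half of the clause from gain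
  `κ < 1` + source `ε`, `τlo ≥ ε/(1−κ)`).  NUMBERS OF RECORD for F-p4g9-2 (kit j308857 hill-climb; p5 j308758 LP-exact): sectorial odd gain of
  `DΦ_{W₀}` 0.50/0.51 at the fixed point vs LP-exact 0.510 (scale-free along the ray to 4 digits); 0.45–0.62 over 48 anisotropic windows of aspect
  1.3–57, no growth with aspect; frozen vs rate-dependent (M = 30, 300) identical to 4 digits.
  Sorries: exactly the four candidate stub texts (`stub_cellLawW_I`, `stub_oneLevelL_I`, `stub_cellLawW_S`, `stub_cellLawW_IS`).  Nothing here
  proves the crux, Onsager's conjecture or anomalous dissipation.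

DESIGN FINDING (for tenure p1 g24 / p5 g6; numbers from g4 PART F, kit j303631/j304121).  (a) RADIAL MARGIN.  For a map that is order-reversing and
homogeneous of degree −1 with fixed shape `S⋆`, EVERY interval `[[S⋆/λ, λS⋆]]` is invariant but with ZERO radial margin: the antipode `λS⋆` is sent
EXACTLY to `S⋆/λ`.  The O(1) strictness of g4 (`κ_H ≤ 0.57`) is ANGULAR (Hilbert projective metric) and does not act radially; the only radial
slack is strict subhomogeneity (`ϑ(Tx)` increasing), of relative size ~1e-7/M² — the SAME thin margin as p5's I-centred reciprocal band (6.25e-7/M²),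
not larger.  `renormStep` does not help: radially `r ↦ (r + g/r)/(1+g)` has slope `(1−g)/(1+g) → −1` in the quasi-static regime `g = gain/cellVisc² ≫ 1`.
(b) WHAT THE S⋆-CENTRING BUYS is not margin but IMMUNITY TO THE CENTRE'S ANISOTROPY: for an exactly reflected map about an anisotropic `S⋆`
(`I ∈ [[S⋆/a, aS⋆]]`, `a > 1`) the I-centred nested clause `NearIso (lo/λ)(hiλ) → NearIso (lo/λ)(hiλ)` forces `lo·hi ≤ a⁻²` AND `lo·hi ≥ a²`, i.e.
it can only close on the subhomogeneity margin against `a⋆ − 1 = 6.98e-7/M²` (g4: the true fixed shape of the cubature word is NOT exactly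
isotropic) — two numbers of the same order 1/T²; the interval clause centred at the true `S⋆` has no such loss.  (c) THE FAMILY.  Each `Φν` has its
own centre `S⋆_ν`; with a COMMON centre `S⋆` and `S⋆_ν ∈ [[S⋆/√μν, √μν S⋆]]` one gets exactly `InInterval S⋆ λ S → InInterval S⋆ (μν·λ) (Φν S)` —
the clause of §2 — and NO margin is needed anywhere provided the defects are summable along the cascade, `∏_i μ(cellVisc i) < ∞` (automatic from
`μ ν ≤ exp(Dν^σ)` and the template): this is `TailDefectBound`.  (d) COST: the interval hypothesis is a MATRIX sandwich of the transverse blocks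
(`B_s(S⋆)/λ ≤ B_s(S) ≤ λB_s(S⋆)`), so the model-side verification needs order-reversal of the slot response in the transverse Loewner order
(g4 target `ExcShapeOrderReversing`; p5's scalar pinch `QSPinch` covers it when `B_s(S⋆)` is scalar on `m̂_s^⊥`, i.e. at an isotropic centre, where
`IntervalWindowClause Φ (isoVisc 1) 1 1 λ₀ Λ β 1` IS p5's reciprocal-band `WindowClause Φ λ₀⁻¹ λ₀ (Λ/λ₀) β` restricted to aspects `≥ λ₀`).
RECOMMENDATION: register v22 with p5's I-centred `∀ ν, WindowClause (Φ ν) lo hi Λ β` if `CubatureThreshold`-type numerics confirm the 1/T² race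
(b) is won with room; keep THIS package as the typed fallback (v22⋆: `stub_cellLawW_I` + `stub_oneLevelL_I` + `chainLower_of_pieces_I` +
`slowVectorClauseF_of_noExF_interval`), whose only new proof obligations are `TailDefectBound` (S) and the lead's consent to the window-agnostic
`stub_oneLevelL_I` (its proof sees the same two facts about `Φ (cellVisc (m+1)) S` it extracts from `WindowClause` today).

LANDING MAP (tenure D24-2 (c), for the prover who lands the sorry-free part as Theorems files `--supports stmt-AnomalousDissipation-24912 --as helper`;
texts verbatim, drop the `Cruxes` namespace for `…Theorems.SolenoidalFractalHomogenisation.LagrangianStep`, skip anything p1's `…OneLevelDefsFamily`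
already provides): F1 `…LagrangianStepOneLevelDefsFamily.lean` ⊇ §1 (`TransLE`, `TransNonneg`, `InInterval` + lemmas), §2 (`IntervalWindowClause`,
`window_straddles_one`), §3 defs (`shapeSeqF`, `chainTensorF`, `aspF` + lemmas, `TailDefectBound`), §5 `IntervalWindowFamily`; F2
`…CellClauseCutsFamily.lean` ⊇ §4 (`SlowVectorClauseF`, `SlowVectorClauseNoExF`, `nearIso_effTensorI`, `exists_effective_singleModeI`,
`slowVectorClauseF_of_noExF_interval`); F3 `…OneLevelGlueLowerFamily.lean` ⊇ §3 facts (`oddSmall_renormStep` … `chainImage_nearIso`) + §5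
`chainLower_of_pieces_I` (hypotheses = the stub TEXTS, so no sorry travels); optional F4 `…SectorialWindow.lean` ⊇ §6 minus `stub_cellLawW_S`
(only if a ∀-W line is revived; for the cubature route it is insurance, D24-2 (f)).  The three `stub_*` texts are NOT landed (they are skeleton texts).
LANDING MAP UPDATE (D24-3, the sectorial × defect typing is OF RECORD, so §6–§7 are no longer optional): F1 additionally ⊇ §6 `OddSectorial` + its
algebra (`sector_add_aux` … `sector_inv`), `SectorialIntervalWindowClause`, §7 `SectorialIntervalWindowFamily`, `SectorialOddChannelBound`,
`sectorialIntervalWindowClause_of_channelBound`, `sector_fix_of_gain_lt_one`, `aspF_one`, `tailDefectBound_one`; F2 additionally ⊇ §7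
`nearIso_effTensorIS`, `exists_effective_singleModeIS`, `slowVectorClauseF_of_noExF_intervalS` / `_familyS`; F3 additionally ⊇ §7 `shapeSeqF_intervalS`,
`shapeSeqF_imageS`, `chainTensorF_nearIsoS`, `chainImage_nearIsoS`, `chainLower_of_pieces_IS`.  Skeleton v2 triple of record (p4 reading of D24-3):
`stub_cellLawW_IS` + `stub_oneLevelL_I` + composition `chainLower_of_pieces_IS` (the I-centred `stub_cellLawW_S` / `chainLower_of_pieces_S` of §6 and the
absolute-guard `stub_cellLawW_I` / `chainLower_of_pieces_I` of §5 remain as the two degenerate instantiations `S⋆ = I, μ ≡ 1` resp. `τ`-free).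
-/

set_option linter.dupNamespace false
set_option linter.unusedVariables false

namespace Summit.AnomalousDissipation.AnomalousDissipation.Cruxes.LagrangianRenormalisationStep.IntervalWindowFamily

open Literature.Analysis Literature.Analysis.FluidPDE Literature.Analysis.FunctionSpaces
open MeasureTheory Set Filter
open scoped ENNReal NNReal InnerProductSpace
open Summit.AnomalousDissipation.AnomalousDissipation.Theorems.SolenoidalFractalHomogenisation.LagrangianStep
open Summit.AnomalousDissipation.AnomalousDissipation.Theorems.SolenoidalFractalHomogenisation.RealisedQuasiStaticCellLaw
  (memLp_two_of_memSobolev_one_complexify memSobolev_one_singleMode isWeaklyDivFree_singleMode)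

noncomputable section

/-- Shapes = viscosity 4-tensors on `𝕋³`. -/
abbrev T4 : Type := Torus.Visc4 (Fin 3)

/-! ## §1 The transverse Loewner order, order intervals, currency conversions -/

/-- TRANSVERSE LOEWNER (pre)ORDER: `S ≼ S'` iff `σ_S(k,p) ≤ σ_{S'}(k,p)` for all transverse pairs `p ⊥ k`. -/
def TransLE (S S' : T4) : Prop :=
  ∀ k p : Fin 3 → ℝ, ∑ i, p i * k i = 0 → Torus.symb S k p ≤ Torus.symb S' k p

/-- Transverse positivity `0 ≼ S`. -/
def TransNonneg (S : T4) : Prop :=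
  ∀ k p : Fin 3 → ℝ, ∑ i, p i * k i = 0 → 0 ≤ Torus.symb S k p

/-- The ORDER INTERVAL (closed part-metric ball of radius `log λ`) about `S⋆`: `S⋆/λ ≼ S ≼ λ S⋆`. -/
def InInterval (Sstar : T4) (lam : ℝ) (S : T4) : Prop :=
  TransLE ((1 / lam) • Sstar) S ∧ TransLE S (lam • Sstar)

theorem TransLE.refl (S : T4) : TransLE S S := fun _ _ _ => le_rfl

theorem TransLE.trans {A B C : T4} (h₁ : TransLE A B) (h₂ : TransLE B C) : TransLE A C :=
  fun k p hkp => (h₁ k p hkp).trans (h₂ k p hkp)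

theorem TransLE.smul {A B : T4} (h : TransLE A B) {c : ℝ} (hc : 0 ≤ c) : TransLE (c • A) (c • B) := by
  intro k p hkp
  rw [Torus.symb_smul, Torus.symb_smul]
  exact mul_le_mul_of_nonneg_left (h k p hkp) hc

theorem TransLE.add {A B A' B' : T4} (h : TransLE A B) (h' : TransLE A' B') : TransLE (A + A') (B + B') := by
  intro k p hkp
  rw [Torus.symb_add, Torus.symb_add]
  exact add_le_add (h k p hkp) (h' k p hkp)

theorem transNonneg_of_nearIso {S : T4} {lo hi : ℝ} (h : Torus.NearIso S lo hi) (hlo : 0 ≤ lo) : TransNonneg S :=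
  fun k p hkp => le_trans (mul_nonneg hlo (by positivity)) (h k p hkp).1

/-- Intervals grow with the aspect (`0 ≼ S⋆`). -/
theorem InInterval.mono {Sstar S : T4} {lam lam' : ℝ} (h : InInterval Sstar lam S) (hpos : TransNonneg Sstar)
    (hlam : 0 < lam) (hle : lam ≤ lam') : InInterval Sstar lam' S := by
  constructor
  · intro k p hkp
    have h1 := h.1 k p hkp
    rw [Torus.symb_smul] at h1 ⊢
    calc (1 / lam') * Torus.symb Sstar k p ≤ (1 / lam) * Torus.symb Sstar k p :=
          mul_le_mul_of_nonneg_right (one_div_le_one_div_of_le hlam hle) (hpos k p hkp)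
      _ ≤ Torus.symb S k p := h1
  · intro k p hkp
    have h2 := h.2 k p hkp
    rw [Torus.symb_smul] at h2 ⊢
    exact h2.trans (mul_le_mul_of_nonneg_right hle (hpos k p hkp))

/-- CONVERSION interval → band: `S ∈ [[S⋆/λ, λS⋆]]`, `NearIso S⋆ slo shi`, `λ ≥ 1` give `NearIso S (slo/λ) (shi·λ)`. -/
theorem InInterval.nearIso {Sstar S : T4} {lam slo shi : ℝ} (hlam : 1 ≤ lam)
    (hstar : Torus.NearIso Sstar slo shi) (hS : InInterval Sstar lam S) :
    Torus.NearIso S (slo / lam) (shi * lam) := by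
  have hlam0 : (0:ℝ) < lam := lt_of_lt_of_le one_pos hlam
  intro k p hkp
  obtain ⟨hl, hh⟩ := hstar k p hkp
  have h1 := hS.1 k p hkp
  have h2 := hS.2 k p hkp
  rw [Torus.symb_smul] at h1 h2
  have hQ : 0 ≤ (∑ a, k a ^ 2) * (∑ i, p i ^ 2) := by positivity
  constructor
  · calc slo / lam * ((∑ a, k a ^ 2) * (∑ i, p i ^ 2)) = (1 / lam) * (slo * ((∑ a, k a ^ 2) * (∑ i, p i ^ 2))) := by ring
      _ ≤ (1 / lam) * Torus.symb Sstar k p := mul_le_mul_of_nonneg_left hl (by positivity)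
      _ ≤ Torus.symb S k p := h1
  · calc Torus.symb S k p ≤ lam * Torus.symb Sstar k p := h2
      _ ≤ lam * (shi * ((∑ a, k a ^ 2) * (∑ i, p i ^ 2))) := mul_le_mul_of_nonneg_left hh (le_of_lt hlam0)
      _ = shi * lam * ((∑ a, k a ^ 2) * (∑ i, p i ^ 2)) := by ring

/-- CONVERSION band → interval: `NearIso S a b` and `NearIso S⋆ slo shi` give `S ∈ [[S⋆/λ, λS⋆]]` as soon as `shi ≤ λ·a` and `b ≤ λ·slo`. -/
theorem inInterval_of_nearIso {Sstar S : T4} {slo shi a b lam : ℝ} (hstar : Torus.NearIso Sstar slo shi)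
    (hS : Torus.NearIso S a b) (hlam : 0 < lam) (h1 : shi ≤ lam * a) (h2 : b ≤ lam * slo) :
    InInterval Sstar lam S := by
  have hne : lam ≠ 0 := hlam.ne'
  constructor
  · intro k p hkp
    rw [Torus.symb_smul]
    have hQ : 0 ≤ (∑ i, k i ^ 2) * (∑ i, p i ^ 2) := by positivity
    obtain ⟨_, hh⟩ := hstar k p hkp
    obtain ⟨ha, _⟩ := hS k p hkp
    calc (1 / lam) * Torus.symb Sstar k p ≤ (1 / lam) * (shi * ((∑ i, k i ^ 2) * (∑ i, p i ^ 2))) :=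
          mul_le_mul_of_nonneg_left hh (by positivity)
      _ ≤ (1 / lam) * (lam * a * ((∑ i, k i ^ 2) * (∑ i, p i ^ 2))) :=
          mul_le_mul_of_nonneg_left (mul_le_mul_of_nonneg_right h1 hQ) (by positivity)
      _ = a * ((∑ i, k i ^ 2) * (∑ i, p i ^ 2)) := by field_simp
      _ ≤ Torus.symb S k p := ha
  · intro k p hkp
    rw [Torus.symb_smul]
    have hQ : 0 ≤ (∑ i, k i ^ 2) * (∑ i, p i ^ 2) := by positivity
    obtain ⟨hl, _⟩ := hstar k p hkp
    obtain ⟨_, hb⟩ := hS k p hkp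
    calc Torus.symb S k p ≤ b * ((∑ i, k i ^ 2) * (∑ i, p i ^ 2)) := hb
      _ ≤ lam * slo * ((∑ i, k i ^ 2) * (∑ i, p i ^ 2)) := mul_le_mul_of_nonneg_right h2 hQ
      _ = lam * (slo * ((∑ i, k i ^ 2) * (∑ i, p i ^ 2))) := by ring
      _ ≤ lam * Torus.symb Sstar k p := mul_le_mul_of_nonneg_left hl hlam.le

/-! ## §2 The interval window clause WITH CENTRE DEFECT `μ` (μ = 1: g4's exact clause) -/

/-- `IntervalWindowClause Φν S⋆ slo shi λ₀ Λ β μ`: the centre `S⋆` has band `[slo, shi]`, the isotropic start `isoVisc 1` lies in `[[S⋆/λ₀, λ₀S⋆]]`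
(`λ₀ ≥ 1`), and for every aspect `λ ∈ [λ₀, Λ]` the guarded interval `{OddSmall β} ∩ [[S⋆/λ, λS⋆]]` is mapped by `Φν` into `{OddSmall β} ∩
[[S⋆/(μλ), μλ S⋆]]`.  For the family: `∀ ν, IntervalWindowClause (Φ ν) S⋆ slo shi λ₀ Λ β (μ ν)` with a COMMON centre and summable defects. -/
def IntervalWindowClause (Φν : T4 → T4) (Sstar : T4) (slo shi lam₀ Λ β μ : ℝ) : Prop :=
  Torus.NearIso Sstar slo shi ∧ 1 ≤ lam₀ ∧ InInterval Sstar lam₀ (Torus.isoVisc 1) ∧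
  ∀ lam ∈ Set.Icc lam₀ Λ, ∀ S : T4, Torus.OddSmall S β → InInterval Sstar lam S →
    Torus.OddSmall (Φν S) β ∧ InInterval Sstar (μ * lam) (Φν S)

/-- The static conjuncts pin the window around `1`: `slo ≤ λ₀` and `1 ≤ λ₀·shi` (tested at the transverse pair `k = e₀`, `p = e₁`) — whence the
stub-text side conditions `lo ≤ 1 ≤ hi` for `lo ≤ slo/Λc`, `hi ≥ shi·Λc`, `Λc ≥ λ₀`. -/
theorem window_straddles_one {Φν : T4 → T4} {Sstar : T4} {slo shi lam₀ Λ β μ : ℝ}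
    (hwin : IntervalWindowClause Φν Sstar slo shi lam₀ Λ β μ) : slo ≤ lam₀ ∧ 1 ≤ lam₀ * shi := by
  obtain ⟨hstar, hlam₀, hiso, _⟩ := hwin
  have hlam0 : (0:ℝ) < lam₀ := by linarith
  set k : Fin 3 → ℝ := fun i => if i = 0 then 1 else 0 with hk
  set p : Fin 3 → ℝ := fun i => if i = 1 then 1 else 0 with hp
  have hkp : ∑ i, p i * k i = 0 := by simp [hk, hp]
  have hQ : (∑ a, k a ^ 2) * (∑ i, p i ^ 2) = 1 := by simp [hk, hp]
  have hI : Torus.symb (Torus.isoVisc 1 : T4) k p = 1 := by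
    obtain ⟨h₁, h₂⟩ := Torus.nearIso_isoVisc (d := Fin 3) 1 k p hkp
    rw [hQ] at h₁ h₂
    linarith
  obtain ⟨hl, hh⟩ := hstar k p hkp
  rw [hQ] at hl hh
  have h1 := hiso.1 k p hkp
  have h2 := hiso.2 k p hkp
  rw [Torus.symb_smul, hI] at h1 h2
  constructor
  · -- (1/λ₀)·slo ≤ (1/λ₀)·symb S⋆ ≤ 1
    have : (1 / lam₀) * slo ≤ 1 := le_trans (mul_le_mul_of_nonneg_left (by simpa using hl) (by positivity)) h1
    rwa [div_mul_eq_mul_div, one_mul, div_le_one hlam0] at this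
  · calc (1:ℝ) ≤ lam₀ * Torus.symb Sstar k p := h2
      _ ≤ lam₀ * shi := mul_le_mul_of_nonneg_left (by simpa using hh) hlam0.le

/-! ## §3 CONSUMER FACT 1 — the chain: every shape of `shapeSeqF` and its `Φ`-image in the window; `NearIso (chainTensorF E Φ j m) (kbar m·lo) (kbar m·hi)` -/

/-- [VERBATIM p1 r24 F1(a)] The shape chain driven by a LEVEL-DEPENDENT family of maps `Ψ i`. -/
def shapeSeqF (Ψ : ℕ → Torus.Visc4 (Fin 3) → Torus.Visc4 (Fin 3)) (g : ℕ → ℝ) (j : ℕ) : ℕ → Torus.Visc4 (Fin 3)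
  | 0 => Torus.isoVisc 1
  | d + 1 => renormStep (Ψ (j - d)) (g (j - d)) (shapeSeqF Ψ g j d)

/-- [VERBATIM p1 r24 F1(b)] The renormalised tensor chain of `E` for a ν-dependent shape map. -/
def chainTensorF {k : ℕ} (E : LatticeShear.LagrangianLatticeCarrier k) (Φ : ℝ → Torus.Visc4 (Fin 3) → Torus.Visc4 (Fin 3)) (j m : ℕ) :
    Torus.Visc4 (Fin 3) :=
  E.kbar m • shapeSeqF (fun i => Φ (E.cellVisc i)) (fun i => E.gain / E.cellVisc i ^ 2) j (j - m)

theorem shapeSeqF_const (Φ : Torus.Visc4 (Fin 3) → Torus.Visc4 (Fin 3)) (g : ℕ → ℝ) (j : ℕ) :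
    shapeSeqF (fun _ => Φ) g j = shapeSeq Φ g j := by
  funext d
  induction d with
  | zero => rfl
  | succ d ih => simp only [shapeSeqF, shapeSeq, ih]

theorem chainTensorF_const {k : ℕ} (E : LatticeShear.LagrangianLatticeCarrier k) (Φ : Torus.Visc4 (Fin 3) → Torus.Visc4 (Fin 3)) (j m : ℕ) :
    chainTensorF E (fun _ => Φ) j m = chainTensor E Φ j m := by
  simp only [chainTensorF, chainTensor, shapeSeqF_const]

/-- The top tensor of the family chain is the isotropic `kbar_j`. -/
theorem chainTensorF_top {k : ℕ} (E : LatticeShear.LagrangianLatticeCarrier k) (Φ : ℝ → Torus.Visc4 (Fin 3) → Torus.Visc4 (Fin 3)) (j : ℕ) :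
    chainTensorF E Φ j j = Torus.isoVisc (E.kbar j) := by
  unfold chainTensorF
  rw [Nat.sub_self, shapeSeqF]
  funext i a j' b
  simp [Torus.isoVisc]

/-- Below the top, level `m` is the renormalisation of the level-`(m+1)` shape THROUGH `Φ (cellVisc (m+1))`. -/
theorem chainTensorF_succ {k : ℕ} (E : LatticeShear.LagrangianLatticeCarrier k) (Φ : ℝ → Torus.Visc4 (Fin 3) → Torus.Visc4 (Fin 3))
    {j m : ℕ} (h : m < j) :
    chainTensorF E Φ j m = E.kbar m • renormStep (Φ (E.cellVisc (m + 1))) (E.gain / E.cellVisc (m + 1) ^ 2)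
      (shapeSeqF (fun i => Φ (E.cellVisc i)) (fun i => E.gain / E.cellVisc i ^ 2) j (j - (m + 1))) := by
  unfold chainTensorF
  have h1 : j - m = (j - (m + 1)) + 1 := by omega
  have h2 : j - (j - (m + 1)) = m + 1 := by omega
  rw [h1]
  simp only [shapeSeqF, h2]

/-- The RUNNING ASPECT of the chain below top level `j`: `aspF μ λ₀ j d = λ₀ · ∏_{i<d} μ (j - i)` (one defect factor per level passed). -/
def aspF (μ : ℕ → ℝ) (lam₀ : ℝ) (j : ℕ) : ℕ → ℝ
  | 0 => lam₀
  | d + 1 => μ (j - d) * aspF μ lam₀ j d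

theorem aspF_eq_prod (μ : ℕ → ℝ) (lam₀ : ℝ) (j : ℕ) :
    ∀ d, aspF μ lam₀ j d = lam₀ * ∏ i ∈ Finset.range d, μ (j - i)
  | 0 => by simp [aspF]
  | d + 1 => by rw [aspF, aspF_eq_prod μ lam₀ j d, Finset.prod_range_succ]; ring

theorem lam₀_le_aspF {μ : ℕ → ℝ} {lam₀ : ℝ} (hμ : ∀ i, 1 ≤ μ i) (h0 : 0 ≤ lam₀) (j : ℕ) :
    ∀ d, lam₀ ≤ aspF μ lam₀ j d
  | 0 => le_rfl
  | d + 1 => by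
      have ih := lam₀_le_aspF hμ h0 j d
      have hnn : 0 ≤ aspF μ lam₀ j d := h0.trans ih
      calc lam₀ ≤ aspF μ lam₀ j d := ih
        _ ≤ μ (j - d) * aspF μ lam₀ j d := le_mul_of_one_le_left hnn (hμ _)

theorem aspF_le_succ {μ : ℕ → ℝ} {lam₀ : ℝ} (hμ : ∀ i, 1 ≤ μ i) (h0 : 0 ≤ lam₀) (j d : ℕ) :
    aspF μ lam₀ j d ≤ aspF μ lam₀ j (d + 1) :=
  le_mul_of_one_le_left (h0.trans (lam₀_le_aspF hμ h0 j d)) (hμ _)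

/-- `renormStep` keeps `OddSmall β` (convex combination; any map). -/
theorem oddSmall_renormStep {Φν : T4 → T4} {β g : ℝ} (hβ : 0 ≤ β) (hg : 0 ≤ g) {S : T4}
    (hSo : Torus.OddSmall S β) (hΦo : Torus.OddSmall (Φν S) β) : Torus.OddSmall (renormStep Φν g S) β := by
  have h := (hSo.add (hΦo.smul g) hβ (mul_nonneg hg hβ)).smul (1 / (1 + g))
  have hne : (1 + g) ≠ 0 := by positivity
  exact oddSmall_congr h (by field_simp)

/-- `renormStep` keeps a `NearIso` band containing `S` and `Φ S` (window-agnostic form of `renormStep_window`). -/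
theorem nearIso_renormStep {Φν : T4 → T4} {lo hi g : ℝ} (hg : 0 ≤ g) {S : T4}
    (hSn : Torus.NearIso S lo hi) (hΦn : Torus.NearIso (Φν S) lo hi) : Torus.NearIso (renormStep Φν g S) lo hi := by
  have hg1 : (0:ℝ) ≤ 1 / (1 + g) := by positivity
  have hne : (1 + g) ≠ 0 := by positivity
  have h := (hSn.add (hΦn.smul hg)).smul hg1
  exact nearIso_congr h (by field_simp) (by field_simp)

/-- `renormStep` keeps every order interval containing `S` and `Φ S` (g4 `renormStep_interval`, any map). -/
theorem renormStep_interval {Φν : T4 → T4} {Sstar : T4} {lam g : ℝ} (hg : 0 ≤ g) {S : T4}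
    (hS : InInterval Sstar lam S) (hΦS : InInterval Sstar lam (Φν S)) :
    InInterval Sstar lam (renormStep Φν g S) := by
  have hg1 : (0:ℝ) ≤ 1 / (1 + g) := by positivity
  have hne : (1 + g) ≠ 0 := by positivity
  have key : ∀ X : T4, (1 / (1 + g)) • (X + g • X) = X := fun X => by
    rw [show X + g • X = (1 + g) • X by rw [add_smul, one_smul], smul_smul, one_div_mul_cancel hne, one_smul]
  constructor
  · have h := ((hS.1.add (hΦS.1.smul hg)).smul hg1)
    rw [key] at h
    exact h
  · have h := ((hS.2.add (hΦS.2.smul hg)).smul hg1)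
    rw [key] at h
    exact h

/-- INDUCTION ALONG THE FAMILY CHAIN.  Under `∀ i, IntervalWindowClause (Ψ i) S⋆ slo shi λ₀ Λ β (μ i)` every shape of depth `d` with running aspect
`aspF μ λ₀ j d ≤ Λ` is `OddSmall β` and lies in `[[S⋆/aspF d, aspF d · S⋆]]`. -/
theorem shapeSeqF_interval {Ψ : ℕ → T4 → T4} {Sstar : T4} {slo shi lam₀ Λ β : ℝ} {μ : ℕ → ℝ}
    (hβ : 0 ≤ β) (hslo : 0 ≤ slo) (hwin : ∀ i, IntervalWindowClause (Ψ i) Sstar slo shi lam₀ Λ β (μ i))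
    (hμ : ∀ i, 1 ≤ μ i) {g : ℕ → ℝ} (hg : ∀ i, 0 ≤ g i) (j : ℕ) :
    ∀ d, aspF μ lam₀ j d ≤ Λ →
      Torus.OddSmall (shapeSeqF Ψ g j d) β ∧ InInterval Sstar (aspF μ lam₀ j d) (shapeSeqF Ψ g j d)
  | 0, _ => ⟨Torus.oddSmall_isoVisc 1 β, (hwin 0).2.2.1⟩
  | d + 1, hΛ => by
      have h0 : (0:ℝ) ≤ lam₀ := zero_le_one.trans (hwin 0).2.1
      have hle : aspF μ lam₀ j d ≤ aspF μ lam₀ j (d + 1) := aspF_le_succ hμ h0 j d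
      obtain ⟨ho, hi'⟩ := shapeSeqF_interval hβ hslo hwin hμ hg j d (hle.trans hΛ)
      have hpos : TransNonneg Sstar := transNonneg_of_nearIso (hwin 0).1 hslo
      have hlam : aspF μ lam₀ j d ∈ Set.Icc lam₀ Λ := ⟨lam₀_le_aspF hμ h0 j d, hle.trans hΛ⟩
      have hlampos : 0 < aspF μ lam₀ j d := lt_of_lt_of_le (lt_of_lt_of_le one_pos (hwin 0).2.1) hlam.1
      obtain ⟨hΦo, hΦi⟩ := (hwin (j - d)).2.2.2 _ hlam _ ho hi'
      exact ⟨oddSmall_renormStep hβ (hg _) ho hΦo, renormStep_interval (hg _) (hi'.mono hpos hlampos hle) hΦi⟩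

/-- … and ONE MORE clause application: the facts about the `Ψ (j-d)`-IMAGE of the depth-`d` shape (what the window-agnostic `stub_oneLevelL_I`
is fed at level `m = j - d - 1`). -/
theorem shapeSeqF_image {Ψ : ℕ → T4 → T4} {Sstar : T4} {slo shi lam₀ Λ β : ℝ} {μ : ℕ → ℝ}
    (hβ : 0 ≤ β) (hslo : 0 ≤ slo) (hwin : ∀ i, IntervalWindowClause (Ψ i) Sstar slo shi lam₀ Λ β (μ i))
    (hμ : ∀ i, 1 ≤ μ i) {g : ℕ → ℝ} (hg : ∀ i, 0 ≤ g i) (j d : ℕ) (hΛ : aspF μ lam₀ j (d + 1) ≤ Λ) :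
    Torus.OddSmall (Ψ (j - d) (shapeSeqF Ψ g j d)) β ∧ InInterval Sstar (aspF μ lam₀ j (d + 1)) (Ψ (j - d) (shapeSeqF Ψ g j d)) := by
  have h0 : (0:ℝ) ≤ lam₀ := zero_le_one.trans (hwin 0).2.1
  have hle : aspF μ lam₀ j d ≤ aspF μ lam₀ j (d + 1) := aspF_le_succ hμ h0 j d
  obtain ⟨ho, hi'⟩ := shapeSeqF_interval hβ hslo hwin hμ hg j d (hle.trans hΛ)
  exact (hwin (j - d)).2.2.2 _ ⟨lam₀_le_aspF hμ h0 j d, hle.trans hΛ⟩ _ ho hi'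

/-- Band of a shape in an interval of aspect `≤ Λc`: `NearIso lo hi` whenever `lo·Λc ≤ slo` and `shi·Λc ≤ hi`. -/
theorem nearIso_of_inInterval_le {Sstar S : T4} {slo shi lam Λc lo hi : ℝ} (hstar : Torus.NearIso Sstar slo shi)
    (hslo : 0 ≤ slo) (hlam1 : 1 ≤ lam) (hlamc : lam ≤ Λc) (hlo : 0 ≤ lo) (hloc : lo * Λc ≤ slo) (hhic : shi * Λc ≤ hi)
    (hS : InInterval Sstar lam S) : Torus.NearIso S lo hi := by
  have hlam0 : 0 < lam := lt_of_lt_of_le one_pos hlam1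
  have hshi : 0 ≤ shi := by
    -- from the interval at any transverse pair: slo ≤ shi follows from hstar where Q > 0; use k = e₀, p = e₁
    set k : Fin 3 → ℝ := fun i => if i = 0 then 1 else 0 with hk
    set p : Fin 3 → ℝ := fun i => if i = 1 then 1 else 0 with hp
    have hkp : ∑ i, p i * k i = 0 := by simp [hk, hp]
    have hQ : (∑ a, k a ^ 2) * (∑ i, p i ^ 2) = 1 := by simp [hk, hp]
    obtain ⟨hl, hh⟩ := hstar k p hkp
    rw [hQ] at hl hh
    linarith
  refine (InInterval.nearIso hlam1 hstar hS).mono ?_ ?_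
  · -- lo ≤ slo/lam  ⟸  lo·lam ≤ lo·Λc ≤ slo
    rw [le_div_iff₀ hlam0]
    exact le_trans (mul_le_mul_of_nonneg_left hlamc hlo) hloc
  · exact le_trans (mul_le_mul_of_nonneg_left hlamc hshi) hhic

/-- SUPPORT (S-sized; NOT proved here): along every permissible carrier on the template the running defect product is EVENTUALLY below the chain
budget `Λc`.  Follows from `∀ ν > 0, μ ν ≤ exp (D ν^σ)` (`D ≥ 0`, `σ > 0`) and `λ₀ < Λc`: `cellVisc (m+1) ≤ (N m/N (m+1))^{1/4} ≤ (N m)^{-1/4}`,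
`N 0 = 1`, `N (m+1) ≥ 2 N m`, so `∑_{i>m₁} cellVisc(i)^σ → 0`. -/
def TailDefectBound (μ : ℝ → ℝ) (lam₀ Λc : ℝ) : Prop :=
  ∀ k (E : LatticeShear.LagrangianLatticeCarrier k), E.LPermissible → (∀ m, E.N m ^ 2 ≤ E.N (m + 1)) →
    (∀ m, E.cellVisc (m + 1) * ((E.N (m + 1) : ℝ) / E.N m) ^ (1 / 4 : ℝ) ≤ 1) →
    ∃ m₁ : ℕ, ∀ j d : ℕ, m₁ + d ≤ j → aspF (fun i => μ (E.cellVisc i)) lam₀ j d ≤ Λc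

/-- **CONSUMER FACT 1 (chain).**  Under the family clause with common centre, defects `μ ≥ 1` and the tail bound from level `m₁` on: for
`m₁ ≤ m ≤ j` the level-`m` shape of the chain below `j` and (for `m₁ ≤ m < j`) the `Φ (cellVisc (m+1))`-image of the level-`(m+1)` shape are
`OddSmall β ∧ NearIso lo hi`, and the level-`m` TENSOR is `NearIso (kbar m·lo) (kbar m·hi)` — the window conjunct of `ChainLower E`. -/
theorem chainTensorF_nearIso {k : ℕ} (E : LatticeShear.LagrangianLatticeCarrier k)
    {Φ : ℝ → T4 → T4} {Sstar : T4} {slo shi lam₀ Λ β : ℝ} {μ : ℝ → ℝ} {Λc lo hi : ℝ}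
    (hβ : 0 ≤ β) (hslo : 0 ≤ slo) (hwin : ∀ ν, IntervalWindowClause (Φ ν) Sstar slo shi lam₀ Λ β (μ ν)) (hμ : ∀ ν, 1 ≤ μ ν)
    (hΛc : Λc ≤ Λ) (hlo : 0 ≤ lo) (hloc : lo * Λc ≤ slo) (hhic : shi * Λc ≤ hi)
    {m₁ : ℕ} (htail : ∀ j d : ℕ, m₁ + d ≤ j → aspF (fun i => μ (E.cellVisc i)) lam₀ j d ≤ Λc)
    {j m : ℕ} (hm : m₁ ≤ m) (hmj : m ≤ j) :
    (Torus.OddSmall (shapeSeqF (fun i => Φ (E.cellVisc i)) (fun i => E.gain / E.cellVisc i ^ 2) j (j - m)) β ∧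
      Torus.NearIso (shapeSeqF (fun i => Φ (E.cellVisc i)) (fun i => E.gain / E.cellVisc i ^ 2) j (j - m)) lo hi) ∧
    Torus.NearIso (chainTensorF E Φ j m) (E.kbar m * lo) (E.kbar m * hi) := by
  have hwin' : ∀ i, IntervalWindowClause (Φ (E.cellVisc i)) Sstar slo shi lam₀ Λ β (μ (E.cellVisc i)) := fun i => hwin _
  have hμ' : ∀ i, 1 ≤ (fun i => μ (E.cellVisc i)) i := fun i => hμ _
  have hgpos : ∀ i, 0 ≤ E.gain / E.cellVisc i ^ 2 := fun i => div_nonneg E.gain_pos.le (sq_nonneg _)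
  have h0 : (0:ℝ) ≤ lam₀ := zero_le_one.trans (hwin 0).2.1
  have hd : m₁ + (j - m) ≤ j := by omega
  have hasp : aspF (fun i => μ (E.cellVisc i)) lam₀ j (j - m) ≤ Λc := htail j (j - m) hd
  obtain ⟨ho, hi'⟩ := shapeSeqF_interval hβ hslo hwin' hμ' hgpos j (j - m) (hasp.trans hΛc)
  have h1 : 1 ≤ aspF (fun i => μ (E.cellVisc i)) lam₀ j (j - m) := le_trans (hwin 0).2.1 (lam₀_le_aspF hμ' h0 j (j - m))
  have hS : Torus.NearIso (shapeSeqF (fun i => Φ (E.cellVisc i)) (fun i => E.gain / E.cellVisc i ^ 2) j (j - m)) lo hi :=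
    nearIso_of_inInterval_le (hwin 0).1 hslo h1 hasp hlo hloc hhic hi'
  exact ⟨⟨ho, hS⟩, hS.smul (E.kbar_pos m).le⟩

/-- The IMAGE facts fed to `stub_oneLevelL_I` at level `m` (`m₁ ≤ m < j`): `S = ` the level-`(m+1)` shape, `Φ (cellVisc (m+1)) S` is `OddSmall β ∧ NearIso lo hi`. -/
theorem chainImage_nearIso {k : ℕ} (E : LatticeShear.LagrangianLatticeCarrier k)
    {Φ : ℝ → T4 → T4} {Sstar : T4} {slo shi lam₀ Λ β : ℝ} {μ : ℝ → ℝ} {Λc lo hi : ℝ}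
    (hβ : 0 ≤ β) (hslo : 0 ≤ slo) (hwin : ∀ ν, IntervalWindowClause (Φ ν) Sstar slo shi lam₀ Λ β (μ ν)) (hμ : ∀ ν, 1 ≤ μ ν)
    (hΛc : Λc ≤ Λ) (hlo : 0 ≤ lo) (hloc : lo * Λc ≤ slo) (hhic : shi * Λc ≤ hi)
    {m₁ : ℕ} (htail : ∀ j d : ℕ, m₁ + d ≤ j → aspF (fun i => μ (E.cellVisc i)) lam₀ j d ≤ Λc)
    {j m : ℕ} (hm : m₁ ≤ m) (hmj : m < j) :
    Torus.OddSmall (Φ (E.cellVisc (m + 1)) (shapeSeqF (fun i => Φ (E.cellVisc i)) (fun i => E.gain / E.cellVisc i ^ 2) j (j - (m + 1)))) β ∧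
    Torus.NearIso (Φ (E.cellVisc (m + 1)) (shapeSeqF (fun i => Φ (E.cellVisc i)) (fun i => E.gain / E.cellVisc i ^ 2) j (j - (m + 1)))) lo hi := by
  have hwin' : ∀ i, IntervalWindowClause (Φ (E.cellVisc i)) Sstar slo shi lam₀ Λ β (μ (E.cellVisc i)) := fun i => hwin _
  have hμ' : ∀ i, 1 ≤ (fun i => μ (E.cellVisc i)) i := fun i => hμ _
  have hgpos : ∀ i, 0 ≤ E.gain / E.cellVisc i ^ 2 := fun i => div_nonneg E.gain_pos.le (sq_nonneg _)
  have h0 : (0:ℝ) ≤ lam₀ := zero_le_one.trans (hwin 0).2.1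
  set d : ℕ := j - (m + 1) with hd_def
  have hjd : j - d = m + 1 := by omega
  have hd1 : m₁ + (d + 1) ≤ j := by omega
  have hasp : aspF (fun i => μ (E.cellVisc i)) lam₀ j (d + 1) ≤ Λc := htail j (d + 1) hd1
  obtain ⟨ho, hi'⟩ := shapeSeqF_image hβ hslo hwin' hμ' hgpos j d (hasp.trans hΛc)
  rw [hjd] at ho hi'
  have h1 : 1 ≤ aspF (fun i => μ (E.cellVisc i)) lam₀ j (d + 1) := le_trans (hwin 0).2.1 (lam₀_le_aspF hμ' h0 j (d + 1))
  exact ⟨ho, nearIso_of_inInterval_le (hwin 0).1 hslo h1 hasp hlo hloc hhic hi'⟩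

/-! ## §4 CONSUMER FACT 2 — F2: ellipticity of the effective tensor, Lions existence, the family adapter (V_ν without existence ⇒ V_ν) -/

/-- [VERBATIM p1 r24 F1(c)] (V) for a ν-DEPENDENT shape map. -/
def SlowVectorClauseF {k : ℕ} (W : LatticeShear.LatticeWord k) (M : ℝ) (hM : 0 < M) (c : ℝ)
    (Φ : ℝ → Torus.Visc4 (Fin 3) → Torus.Visc4 (Fin 3)) (lo hi Λ β σ C ν₀ K : ℝ) : Prop :=
      ∀ ν, ∀ hν : ν ∈ Set.Ioo 0 ν₀, ∀ n : ℕ, ∀ 𝔸 : Torus.Visc4 (Fin 3),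
        Torus.OddSmall 𝔸 (ν * β) → (∃ lam ∈ Set.Icc (1:ℝ) Λ, Torus.NearIso 𝔸 (ν * (lo / lam)) (ν * (hi * lam))) →
        ∀ ℓ : Fin 3 → ℤ, ℓ ≠ 0 → ‖Torus.latticeVec ℓ‖ * (⌈K / ν⌉₊ : ℝ) ≤ n →
        ∀ p : EuclideanSpace ℝ (Fin 3), ‖p‖ = 1 → ⟪p, Torus.latticeVec ℓ⟫_ℝ = 0 →
        ∀ T > (0:ℝ),
          (∃ v : ℝ → VF, Torus.IsWeakTensorPassiveVectorOn 0 (2 * T) ((1 / (n:ℝ) ^ 2) • (𝔸 + (c / ν) • Φ ν ((1 / ν) • 𝔸))) (fun _ _ => 0)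
                (fun x => (UnitAddTorus.mFourier ℓ x).re • p) v) ∧
          ∀ w v : ℝ → VF,
            Torus.IsWeakTensorPassiveVectorOn 0 T ((1 / (n:ℝ) ^ 2) • 𝔸) (cellField W M hM ν hν.1 n) (fun x => (UnitAddTorus.mFourier ℓ x).re • p) w →
            Torus.IsWeakTensorPassiveVectorOn 0 (2 * T) ((1 / (n:ℝ) ^ 2) • (𝔸 + (c / ν) • Φ ν ((1 / ν) • 𝔸))) (fun _ _ => 0)
                (fun x => (UnitAddTorus.mFourier ℓ x).re • p) v →
            ∀ᵐ t ∂(volume.restrict (Ioo 0 T)),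
              2 * ∑ i, ‖modeCoeff ℓ (fun x => w t x - v t x) i‖ ^ 2
                  ≤ (C * (C * (ν ^ σ + (‖Torus.latticeVec ℓ‖ * (⌈K / ν⌉₊ : ℝ) / n) ^ σ) * min 1 ((8 * Real.pi ^ 2 * ‖Torus.latticeVec ℓ‖ ^ 2 * (hi * Λ) * (ν + c / ν) / (n:ℝ) ^ 2) * t) + (8 * Real.pi ^ 2 * ‖Torus.latticeVec ℓ‖ ^ 2 * (hi * Λ) * (ν + c / ν) / (n:ℝ) ^ 2) * (M * W.period / ν))) ^ 2
                      * ∫ x, ‖(UnitAddTorus.mFourier ℓ x).re • p‖ ^ 2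

/-- [VERBATIM p1 r24 F2(a)] (V) for the family WITHOUT its existence conjunct. -/
def SlowVectorClauseNoExF {k : ℕ} (W : LatticeShear.LatticeWord k) (M : ℝ) (hM : 0 < M) (c : ℝ)
    (Φ : ℝ → Torus.Visc4 (Fin 3) → Torus.Visc4 (Fin 3)) (lo hi Λ β σ C ν₀ K : ℝ) : Prop :=
      ∀ ν, ∀ hν : ν ∈ Set.Ioo 0 ν₀, ∀ n : ℕ, ∀ 𝔸 : Torus.Visc4 (Fin 3),
        Torus.OddSmall 𝔸 (ν * β) → (∃ lam ∈ Set.Icc (1:ℝ) Λ, Torus.NearIso 𝔸 (ν * (lo / lam)) (ν * (hi * lam))) →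
        ∀ ℓ : Fin 3 → ℤ, ℓ ≠ 0 → ‖Torus.latticeVec ℓ‖ * (⌈K / ν⌉₊ : ℝ) ≤ n →
        ∀ p : EuclideanSpace ℝ (Fin 3), ‖p‖ = 1 → ⟪p, Torus.latticeVec ℓ⟫_ℝ = 0 →
        ∀ T > (0:ℝ),
          ∀ w v : ℝ → VF,
            Torus.IsWeakTensorPassiveVectorOn 0 T ((1 / (n:ℝ) ^ 2) • 𝔸) (cellField W M hM ν hν.1 n) (fun x => (UnitAddTorus.mFourier ℓ x).re • p) w →
            Torus.IsWeakTensorPassiveVectorOn 0 (2 * T) ((1 / (n:ℝ) ^ 2) • (𝔸 + (c / ν) • Φ ν ((1 / ν) • 𝔸))) (fun _ _ => 0)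
                (fun x => (UnitAddTorus.mFourier ℓ x).re • p) v →
            ∀ᵐ t ∂(volume.restrict (Ioo 0 T)),
              2 * ∑ i, ‖modeCoeff ℓ (fun x => w t x - v t x) i‖ ^ 2
                  ≤ (C * (C * (ν ^ σ + (‖Torus.latticeVec ℓ‖ * (⌈K / ν⌉₊ : ℝ) / n) ^ σ) * min 1 ((8 * Real.pi ^ 2 * ‖Torus.latticeVec ℓ‖ ^ 2 * (hi * Λ) * (ν + c / ν) / (n:ℝ) ^ 2) * t) + (8 * Real.pi ^ 2 * ‖Torus.latticeVec ℓ‖ ^ 2 * (hi * Λ) * (ν + c / ν) / (n:ℝ) ^ 2) * (M * W.period / ν))) ^ 2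
                      * ∫ x, ‖(UnitAddTorus.mFourier ℓ x).re • p‖ ^ 2

/-- **CONSUMER FACT 2 (F2): ellipticity of the effective tensor from the interval clause.**  For `(1/ν)•𝔸` in the guarded interval of aspect
`λ ∈ [λ₀, Λ]`, the effective cell tensor `(1/n²)•(𝔸 + (c/ν)•Φν((1/ν)•𝔸))` is `NearIso` with the positive lower constant `(1/n²)(ν + c/ν)·slo/(μλ)`. -/
theorem nearIso_effTensorI {Φν : T4 → T4} {Sstar : T4} {slo shi lam₀ Λ β μ : ℝ}
    (hwin : IntervalWindowClause Φν Sstar slo shi lam₀ Λ β μ) (hμ : 1 ≤ μ) (hslo : 0 ≤ slo)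
    {ν c : ℝ} (hν : 0 < ν) (hc : 0 ≤ c) {n : ℕ} {𝔸 : T4} (hodd : Torus.OddSmall 𝔸 (ν * β))
    {lam : ℝ} (hlam : lam ∈ Set.Icc lam₀ Λ) (hA : InInterval Sstar lam ((1 / ν) • 𝔸)) :
    Torus.NearIso ((1 / (n:ℝ) ^ 2) • (𝔸 + (c / ν) • Φν ((1 / ν) • 𝔸)))
      ((1 / (n:ℝ) ^ 2) * ((ν + c / ν) * (slo / (μ * lam)))) ((1 / (n:ℝ) ^ 2) * ((ν + c / ν) * (shi * (μ * lam)))) := by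
  obtain ⟨hstar, hlam₀, _, hstep⟩ := hwin
  have hlam1 : 1 ≤ lam := le_trans hlam₀ hlam.1
  have hlampos : 0 < lam := lt_of_lt_of_le one_pos hlam1
  have hμlam : 1 ≤ μ * lam := one_le_mul_of_one_le_of_one_le hμ hlam1
  have hle : lam ≤ μ * lam := le_mul_of_one_le_left hlampos.le hμ
  have hodd' : Torus.OddSmall ((1 / ν) • 𝔸) β := by
    have h := hodd.smul (1 / ν)
    exact oddSmall_congr h (by field_simp)
  obtain ⟨_, hΦi⟩ := hstep lam hlam _ hodd' hA
  have hpos : TransNonneg Sstar := transNonneg_of_nearIso hstar hslo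
  have hX : Torus.NearIso ((1 / ν) • 𝔸) (slo / (μ * lam)) (shi * (μ * lam)) :=
    InInterval.nearIso hμlam hstar (hA.mono hpos hlampos hle)
  have hΦ : Torus.NearIso (Φν ((1 / ν) • 𝔸)) (slo / (μ * lam)) (shi * (μ * lam)) := InInterval.nearIso hμlam hstar hΦi
  have hA𝔸 : Torus.NearIso 𝔸 (ν * (slo / (μ * lam))) (ν * (shi * (μ * lam))) := by
    have h := hX.smul (c := ν) hν.le
    rwa [smul_smul, mul_one_div_cancel hν.ne', one_smul] at h
  have hcν : 0 ≤ c / ν := div_nonneg hc hν.le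
  have hsum := hA𝔸.add (hΦ.smul hcν)
  have hn : (0:ℝ) ≤ 1 / (n:ℝ) ^ 2 := by positivity
  have h := hsum.smul hn
  exact nearIso_congr h (by ring) (by ring)

/-- **Existence of the effective single-mode solution for the family** from the interval clause (Lions), with the (V)-text window hypothesis in
`NearIso` currency and the explicit compatibility inequalities `ΛV·shi ≤ Λ'·lo`, `ΛV·hi ≤ Λ'·slo`, `Λ' ∈ [λ₀, Λ]`.
[cite: LionsMagenes1972, Chap. 3 Thm. 1.1] -/
theorem exists_effective_singleModeI {Φν : T4 → T4} {Sstar : T4} {slo shi lam₀ Λ β μ : ℝ}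
    (hwin : IntervalWindowClause Φν Sstar slo shi lam₀ Λ β μ) (hμ : 1 ≤ μ) (hslo : 0 < slo)
    {lo hi ΛV Λ' : ℝ} (hlo : 0 < lo) (hhi : 0 ≤ hi) (hΛ' : Λ' ∈ Set.Icc lam₀ Λ)
    (hc1 : ΛV * shi ≤ Λ' * lo) (hc2 : ΛV * hi ≤ Λ' * slo)
    {ν c K : ℝ} (hν : 0 < ν) (hc : 0 ≤ c) (hK : 0 < K) {n : ℕ}
    {𝔸 : T4} (hodd : Torus.OddSmall 𝔸 (ν * β))
    (hwin' : ∃ lam ∈ Set.Icc (1:ℝ) ΛV, Torus.NearIso 𝔸 (ν * (lo / lam)) (ν * (hi * lam)))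
    {ℓ : Fin 3 → ℤ} (hℓ : ℓ ≠ 0) (hsep : ‖Torus.latticeVec ℓ‖ * (⌈K / ν⌉₊ : ℝ) ≤ n)
    {p : EuclideanSpace ℝ (Fin 3)} (hperp : ⟪p, Torus.latticeVec ℓ⟫_ℝ = 0) {T : ℝ} (hT : 0 < T) :
    ∃ v : ℝ → VF, Torus.IsWeakTensorPassiveVectorOn 0 (2 * T) ((1 / (n:ℝ) ^ 2) • (𝔸 + (c / ν) • Φν ((1 / ν) • 𝔸))) (fun _ _ => 0)
      (fun x => (UnitAddTorus.mFourier ℓ x).re • p) v := by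
  obtain ⟨lam, hlam, hA⟩ := hwin'
  have hlam0 : 0 < lam := lt_of_lt_of_le one_pos hlam.1
  have hΛ'1 : 1 ≤ Λ' := le_trans hwin.2.1 hΛ'.1
  have hΛ'pos : 0 < Λ' := lt_of_lt_of_le one_pos hΛ'1
  have hshi : 0 < shi := by
    have h := (window_straddles_one hwin).2
    have hl0 : 0 < lam₀ := lt_of_lt_of_le one_pos hwin.2.1
    by_contra hneg
    push Not at hneg
    have : lam₀ * shi ≤ 0 := mul_nonpos_of_nonneg_of_nonpos hl0.le hneg
    linarith
  have hX : Torus.NearIso ((1 / ν) • 𝔸) (lo / lam) (hi * lam) := by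
    have h := hA.smul (c := 1 / ν) (by positivity)
    exact nearIso_congr h (by field_simp) (by field_simp)
  have h1 : shi ≤ Λ' * (lo / lam) := by
    rw [mul_div_assoc', le_div_iff₀ hlam0]
    calc shi * lam ≤ shi * ΛV := mul_le_mul_of_nonneg_left hlam.2 hshi.le
      _ = ΛV * shi := mul_comm _ _
      _ ≤ Λ' * lo := hc1
  have h2 : hi * lam ≤ Λ' * slo := by
    calc hi * lam ≤ hi * ΛV := mul_le_mul_of_nonneg_left hlam.2 hhi
      _ = ΛV * hi := mul_comm _ _
      _ ≤ Λ' * slo := hc2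
  have hI : InInterval Sstar Λ' ((1 / ν) • 𝔸) := inInterval_of_nearIso hwin.1 hX hΛ'pos h1 h2
  have hN := nearIso_effTensorI (n := n) (c := c) hwin hμ hslo.le hν hc hodd hΛ' hI
  have hn1 : 1 ≤ (n:ℝ) := one_le_of_slowBand hℓ hK hν hsep
  have hn0 : (0:ℝ) < (n:ℝ) := lt_of_lt_of_le one_pos hn1
  have hlo' : 0 < (1 / (n:ℝ) ^ 2) * ((ν + c / ν) * (slo / (μ * Λ'))) := by
    have : 0 < ν + c / ν := by positivity
    have : 0 < μ * Λ' := mul_pos (lt_of_lt_of_le one_pos hμ) hΛ'pos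
    positivity
  exact FluidPDE.Torus.exists_isWeakTensorPassiveVectorOn_zero_carrier (by linarith) hN hlo'
    (memLp_two_of_memSobolev_one_complexify (memSobolev_one_singleMode ℓ p))
    (isWeaklyDivFree_singleMode ℓ hperp)

/-- **THE FAMILY ADAPTER (V_ν without existence ⇒ V_ν) from the interval window** — the F2 file's `cellLawVF_of_cellLawVNoExF` core with
`IntervalWindowClause` in place of `WindowClause`. -/
theorem slowVectorClauseF_of_noExF_interval {k : ℕ} {W : LatticeShear.LatticeWord k} {M : ℝ} {hM : 0 < M} {c : ℝ}
    {Φ : ℝ → T4 → T4} {Sstar : T4} {slo shi lam₀ Λ β : ℝ} {μ : ℝ → ℝ} {lo hi ΛV Λ' σ C ν₀ K : ℝ}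
    (hc : 0 < c) (hwin : ∀ ν, IntervalWindowClause (Φ ν) Sstar slo shi lam₀ Λ β (μ ν)) (hμ : ∀ ν, 1 ≤ μ ν) (hslo : 0 < slo)
    (hlo : 0 < lo) (hhi : 0 ≤ hi) (hK : 0 < K) (hΛ' : Λ' ∈ Set.Icc lam₀ Λ) (hc1 : ΛV * shi ≤ Λ' * lo) (hc2 : ΛV * hi ≤ Λ' * slo)
    (h : SlowVectorClauseNoExF W M hM c Φ lo hi ΛV β σ C ν₀ K) : SlowVectorClauseF W M hM c Φ lo hi ΛV β σ C ν₀ K := by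
  intro ν hν n 𝔸 hodd hwin' ℓ hℓ hsep p hp hperp T hT
  exact ⟨exists_effective_singleModeI (hwin ν) (hμ ν) hslo hlo hhi hΛ' hc1 hc2 hν.1 hc.le hK hodd hwin' hℓ hsep hperp hT,
    h ν hν n 𝔸 hodd hwin' ℓ hℓ hsep p hp hperp T hT⟩

/-! ## §5 The package, candidate v22⋆ stub texts, and the PROVED re-plumbed glue -/

/-- **THE INTERVAL WINDOW PACKAGE for the family** (what `stub_cellLawW_I` must output besides (V_ν)): the clause for every `ν` with a common centre,
defects `μ ≥ 1` with the tail bound, and the seven bookkeeping inequalities tying the clause's `(slo, shi, λ₀, Λ)` to the chain budget `Λc`, the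
conversion aspect `Λ'` and the stub-text window `(lo, hi, ΛV)` of (V)/(T)/(L): `λ₀ ≤ Λc ≤ Λ`, `lo·Λc ≤ slo`, `shi·Λc ≤ hi` (chain side),
`Λ' ∈ [λ₀, Λ]`, `ΛV·shi ≤ Λ'·lo`, `ΛV·hi ≤ Λ'·slo` (F2 side). -/
def IntervalWindowFamily (Φ : ℝ → T4 → T4) (μ : ℝ → ℝ) (Sstar : T4) (slo shi lam₀ Λ Λc Λ' β lo hi ΛV : ℝ) : Prop :=
  (∀ ν, IntervalWindowClause (Φ ν) Sstar slo shi lam₀ Λ β (μ ν)) ∧ (∀ ν, 1 ≤ μ ν) ∧ TailDefectBound μ lam₀ Λc ∧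
  0 < slo ∧ lam₀ ≤ Λc ∧ Λc ≤ Λ ∧ lo * Λc ≤ slo ∧ shi * Λc ≤ hi ∧
  Λ' ∈ Set.Icc lam₀ Λ ∧ ΛV * shi ≤ Λ' * lo ∧ ΛV * hi ≤ Λ' * slo

/-- CANDIDATE v22⋆ text of the WINDOW+LAW stub (`stub_cellLawV` with `IntervalWindowFamily` in place of `∀ ν, WindowClause (Φ ν) lo hi Λ β`).
Sorried ONLY to show it elaborates; not registered. -/
theorem stub_cellLawW_I : ∀ k (W : Literature.Analysis.FluidPDE.LatticeShear.LatticeWord k) (c₀ : ℝ), 0 < c₀ →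
    Literature.Analysis.FluidPDE.LatticeShear.IsotropicWordGain W c₀ → ScalarLawBlock W c₀ →
    ∃ M : ℝ, ∃ hM : 0 < M, ∃ c > (0:ℝ), ∃ Φ : ℝ → Torus.Visc4 (Fin 3) → Torus.Visc4 (Fin 3), ∃ μ : ℝ → ℝ,
      ∃ Sstar : Torus.Visc4 (Fin 3), ∃ slo shi lam₀ Λ Λc Λ' : ℝ,
      ∃ lo > (0:ℝ), ∃ hi : ℝ, lo ≤ 1 ∧ 1 ≤ hi ∧ ∃ ΛV > (1:ℝ), ∃ β ≥ (0:ℝ),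
      IntervalWindowFamily Φ μ Sstar slo shi lam₀ Λ Λc Λ' β lo hi ΛV ∧
      ∃ σ > (0:ℝ), ∃ C : ℝ, 0 ≤ C ∧ ∃ ν₀ > (0:ℝ), ∃ K > (0:ℝ), SlowVectorClauseNoExF W M hM c Φ lo hi ΛV β σ C ν₀ K := by
  sorry

/-- CANDIDATE v22⋆ text of `stub_oneLevelL` — WINDOW-AGNOSTIC (consent ask to the lead): NO window-clause binder; the two facts about
`Φ (cellVisc (m+1)) S` that the level-`m` proof needs (`OddSmall β`, `NearIso lo hi` of the renormalising image) are HYPOTHESES on `S`, supplied by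
the glue from whichever window clause is registered (`WindowClause`, `∀ ν WindowClause (Φ ν)`, or `IntervalWindowFamily`).  Every other byte = v22. -/
theorem stub_oneLevelL_I : ∀ k (W : Literature.Analysis.FluidPDE.LatticeShear.LatticeWord k) (M : ℝ) (hM : 0 < M) (c : ℝ), 0 < c →
    ∀ (Φ : ℝ → Torus.Visc4 (Fin 3) → Torus.Visc4 (Fin 3)) (lo hi Λ β σ C ν₀ K Cf νf Kf : ℝ),
      0 < lo → lo ≤ 1 → 1 ≤ hi → 1 < Λ → 0 ≤ β →
      0 < σ → 0 ≤ C → 0 < ν₀ → 0 < K → SlowVectorClauseF W M hM c Φ lo hi Λ β σ C ν₀ K →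
      0 ≤ Cf → 0 < νf → 0 < Kf → CellEnergyClauses W M hM c lo hi Λ β Cf νf Kf →
      ∃ ν₁ > (0:ℝ), ∃ K₁ > (0:ℝ), ∃ Λ₀ : ℕ, ∃ θ₀ > (0:ℝ), ∃ C₁ > (0:ℝ), ∃ σ₁ > (0:ℝ),
        ∀ E : Literature.Analysis.FluidPDE.LatticeShear.LagrangianLatticeCarrier k, E.design = W.stretch M hM → E.gain = c → E.nu0 = ν₁ → E.K = K₁ → E.LPermissible → E.Regular → (∀ m, Λ₀ * E.N m ≤ E.N (m + 1)) → (∀ m, E.N m ^ 2 ≤ E.N (m + 1)) → (∀ m, E.cellVisc (m + 1) * ((E.N (m + 1) : ℝ) / E.N m) ^ (1 / 4 : ℝ) ≤ 1) → (∀ m, E.K * ((E.N (m + 1) : ℝ) / E.N m) ^ (1 / 4 : ℝ) ≤ ((E.N (m + 1) : ℝ) / E.N m) * E.cellVisc (m + 1)) → (∀ m, E.θ (m + 1) * ((E.N (m + 1) : ℝ) / E.N m) ^ (1 / 16 : ℝ) ≤ θ₀) → (∀ m, ((E.N (m + 1) : ℝ) / E.N m) ^ (1 / 16 : ℝ) *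 E.physPeriod (m + 1) ≤ E.refresh (m + 1)) →
        ∀ R : ℝ≥0, ∃ mstar : ℕ, ∀ m, mstar ≤ m →
          ∀ S : Torus.Visc4 (Fin 3), Torus.OddSmall S β → Torus.NearIso S lo hi →
            Torus.OddSmall (Φ (E.cellVisc (m + 1)) S) β → Torus.NearIso (Φ (E.cellVisc (m + 1)) S) lo hi →
          ∀ (w₀ : VF), IsDatum w₀ → InClass R w₀ →
          ∀ u v : ℝ → VF, TSol E (m + 1) (E.kbar (m + 1) • S) w₀ u →
            TSol E m (E.kbar m • renormStep (Φ (E.cellVisc (m + 1))) (E.gain / E.cellVisc (m + 1) ^ 2) S) w₀ v →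
            ∀ᵐ t ∂(volume.restrict (Ioo (1/2 : ℝ) 1)),
              (1 - C₁ * ((E.N m : ℝ) / E.N (m + 1)) ^ σ₁) * drop w₀ v t ≤ drop w₀ u t := by
  sorry

/-- SANITY (checked): the window-agnostic text IMPLIES p1's v22 text under ANY `∀ ν, WindowClause (Φ ν) lo hi Λ β` — the two extra hypotheses on `S`
are read off the window clause at `λ = 1`.  So `stub_oneLevelL_I` is a drop-in strengthening; conversely the lead's v21/v22 proof transfers iff it
uses `hwin` only to produce these two facts (the consent question). -/
example (hI : ∀ k (W : Literature.Analysis.FluidPDE.LatticeShear.LatticeWord k) (M : ℝ) (hM : 0 < M) (c : ℝ), 0 < c →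
    ∀ (Φ : ℝ → Torus.Visc4 (Fin 3) → Torus.Visc4 (Fin 3)) (lo hi Λ β σ C ν₀ K Cf νf Kf : ℝ),
      0 < lo → lo ≤ 1 → 1 ≤ hi → 1 < Λ → 0 ≤ β →
      0 < σ → 0 ≤ C → 0 < ν₀ → 0 < K → SlowVectorClauseF W M hM c Φ lo hi Λ β σ C ν₀ K →
      0 ≤ Cf → 0 < νf → 0 < Kf → CellEnergyClauses W M hM c lo hi Λ β Cf νf Kf →
      ∃ ν₁ > (0:ℝ), ∃ K₁ > (0:ℝ), ∃ Λ₀ : ℕ, ∃ θ₀ > (0:ℝ), ∃ C₁ > (0:ℝ), ∃ σ₁ > (0:ℝ),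
        ∀ E : Literature.Analysis.FluidPDE.LatticeShear.LagrangianLatticeCarrier k, E.design = W.stretch M hM → E.gain = c → E.nu0 = ν₁ → E.K = K₁ → E.LPermissible → E.Regular → (∀ m, Λ₀ * E.N m ≤ E.N (m + 1)) → (∀ m, E.N m ^ 2 ≤ E.N (m + 1)) → (∀ m, E.cellVisc (m + 1) * ((E.N (m + 1) : ℝ) / E.N m) ^ (1 / 4 : ℝ) ≤ 1) → (∀ m, E.K * ((E.N (m + 1) : ℝ) / E.N m) ^ (1 / 4 : ℝ) ≤ ((E.N (m + 1) : ℝ) / E.N m) * E.cellVisc (m + 1)) → (∀ m, E.θ (m + 1) * ((E.N (m + 1) : ℝ) / E.N m) ^ (1 / 16 : ℝ) ≤ θ₀) → (∀ m, ((E.N (m + 1) : ℝ) / E.N m) ^ (1 / 16 : ℝ) * E.physPeriod (m + 1) ≤ E.refresh (m + 1)) →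
        ∀ R : ℝ≥0, ∃ mstar : ℕ, ∀ m, mstar ≤ m →
          ∀ S : Torus.Visc4 (Fin 3), Torus.OddSmall S β → Torus.NearIso S lo hi →
            Torus.OddSmall (Φ (E.cellVisc (m + 1)) S) β → Torus.NearIso (Φ (E.cellVisc (m + 1)) S) lo hi →
          ∀ (w₀ : VF), IsDatum w₀ → InClass R w₀ →
          ∀ u v : ℝ → VF, TSol E (m + 1) (E.kbar (m + 1) • S) w₀ u →
            TSol E m (E.kbar m • renormStep (Φ (E.cellVisc (m + 1))) (E.gain / E.cellVisc (m + 1) ^ 2) S) w₀ v →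
            ∀ᵐ t ∂(volume.restrict (Ioo (1/2 : ℝ) 1)),
              (1 - C₁ * ((E.N m : ℝ) / E.N (m + 1)) ^ σ₁) * drop w₀ v t ≤ drop w₀ u t) :
    ∀ k (W : Literature.Analysis.FluidPDE.LatticeShear.LatticeWord k) (M : ℝ) (hM : 0 < M) (c : ℝ), 0 < c →
    ∀ (Φ : ℝ → Torus.Visc4 (Fin 3) → Torus.Visc4 (Fin 3)) (lo hi Λ β σ C ν₀ K Cf νf Kf : ℝ),
      0 < lo → lo ≤ 1 → 1 ≤ hi → 1 < Λ → 0 ≤ β → (∀ ν, WindowClause (Φ ν) lo hi Λ β) →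
      0 < σ → 0 ≤ C → 0 < ν₀ → 0 < K → SlowVectorClauseF W M hM c Φ lo hi Λ β σ C ν₀ K →
      0 ≤ Cf → 0 < νf → 0 < Kf → CellEnergyClauses W M hM c lo hi Λ β Cf νf Kf →
      ∃ ν₁ > (0:ℝ), ∃ K₁ > (0:ℝ), ∃ Λ₀ : ℕ, ∃ θ₀ > (0:ℝ), ∃ C₁ > (0:ℝ), ∃ σ₁ > (0:ℝ),
        ∀ E : Literature.Analysis.FluidPDE.LatticeShear.LagrangianLatticeCarrier k, E.design = W.stretch M hM → E.gain = c → E.nu0 = ν₁ → E.K = K₁ → E.LPermissible → E.Regular → (∀ m, Λ₀ * E.N m ≤ E.N (m + 1)) → (∀ m, E.N m ^ 2 ≤ E.N (m + 1)) → (∀ m, E.cellVisc (m + 1) * ((E.N (m + 1) : ℝ) / E.N m) ^ (1 / 4 : ℝ) ≤ 1) → (∀ m, E.K * ((E.N (m + 1) : ℝ) / E.N m) ^ (1 / 4 : ℝ) ≤ ((E.N (m + 1) : ℝ) / E.N m) * E.cellVisc (m + 1)) → (∀ m, E.θ (m + 1) * ((E.N (m + 1) : ℝ) / E.N m) ^ (1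 / 16 : ℝ) ≤ θ₀) → (∀ m, ((E.N (m + 1) : ℝ) / E.N m) ^ (1 / 16 : ℝ) * E.physPeriod (m + 1) ≤ E.refresh (m + 1)) →
        ∀ R : ℝ≥0, ∃ mstar : ℕ, ∀ m, mstar ≤ m →
          ∀ S : Torus.Visc4 (Fin 3), Torus.OddSmall S β → Torus.NearIso S lo hi →
          ∀ (w₀ : VF), IsDatum w₀ → InClass R w₀ →
          ∀ u v : ℝ → VF, TSol E (m + 1) (E.kbar (m + 1) • S) w₀ u →
            TSol E m (E.kbar m • renormStep (Φ (E.cellVisc (m + 1))) (E.gain / E.cellVisc (m + 1) ^ 2) S) w₀ v →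
            ∀ᵐ t ∂(volume.restrict (Ioo (1/2 : ℝ) 1)),
              (1 - C₁ * ((E.N m : ℝ) / E.N (m + 1)) ^ σ₁) * drop w₀ v t ≤ drop w₀ u t := by
  intro k W M hM c hc Φ lo hi Λ β σ C ν₀ K Cf νf Kf hlo hlo1 hhi1 hΛ hβ hwin hσ hC hν₀ hK hV hCf hνf hKf hEcl
  obtain ⟨ν₁, hν₁, K₁, hK₁, Λ₀, θ₀, hθ₀, C₁, hC₁, σ₁, hσ₁, hE⟩ :=
    hI k W M hM c hc Φ lo hi Λ β σ C ν₀ K Cf νf Kf hlo hlo1 hhi1 hΛ hβ hσ hC hν₀ hK hV hCf hνf hKf hEcl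
  refine ⟨ν₁, hν₁, K₁, hK₁, Λ₀, θ₀, hθ₀, C₁, hC₁, σ₁, hσ₁, fun E hW hg hn hK' hP hR h1 h2 h3 h4 h5 h6 R => ?_⟩
  obtain ⟨mstar, hm⟩ := hE E hW hg hn hK' hP hR h1 h2 h3 h4 h5 h6 R
  refine ⟨mstar, fun m hmm S hSo hSn => ?_⟩
  have h1' : (1:ℝ) ∈ Set.Icc (1:ℝ) Λ := ⟨le_rfl, hΛ.le⟩
  obtain ⟨hΦo, hΦn⟩ := hwin (E.cellVisc (m + 1)) 1 h1' S hSo (by simpa using hSn)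
  exact hm m hmm S hSo hSn hΦo (by simpa using hΦn)

/-- **THE RE-PLUMBED GLUE, PROVED (`chainLower_of_pieces` p629119 through the interval package).**  From the base estimate (`stub_baseT` text),
the window-agnostic one-level step `stub_oneLevelL_I` and the data output by `stub_cellLawW_I` / `stub_cellEnergyT`: `ChainLower E` for every
carrier on the template — window conjunct by `chainTensorF_nearIso`, the two image facts by `chainImage_nearIso`, existence by `existsL_tensor`,
`mstar ↦ max mstar m₁` with `m₁` from `TailDefectBound`. -/
theorem chainLower_of_pieces_I
    (hba : ∀ k (E : LatticeShear.LagrangianLatticeCarrier k), E.LPermissible → E.Regular →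
    ∀ (m : ℕ) (𝔸 : Torus.Visc4 (Fin 3)) (lo hi : ℝ), 0 < lo → Torus.NearIso 𝔸 lo hi →
      ∀ (w₀ : VF) (u : ℝ → VF), IsDatum w₀ → TSol E m 𝔸 w₀ u →
        ∀ᵐ t ∂(volume.restrict (Ioo (1/2 : ℝ) 1)),
          (1 - Real.exp (-(4 * Real.pi ^ 2 * lo))) * Torus.vectorL2Sq w₀ ≤ drop w₀ u t)
    (hone : ∀ k (W : Literature.Analysis.FluidPDE.LatticeShear.LatticeWord k) (M : ℝ) (hM : 0 < M) (c : ℝ), 0 < c →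
    ∀ (Φ : ℝ → Torus.Visc4 (Fin 3) → Torus.Visc4 (Fin 3)) (lo hi Λ β σ C ν₀ K Cf νf Kf : ℝ),
      0 < lo → lo ≤ 1 → 1 ≤ hi → 1 < Λ → 0 ≤ β →
      0 < σ → 0 ≤ C → 0 < ν₀ → 0 < K → SlowVectorClauseF W M hM c Φ lo hi Λ β σ C ν₀ K →
      0 ≤ Cf → 0 < νf → 0 < Kf → CellEnergyClauses W M hM c lo hi Λ β Cf νf Kf →
      ∃ ν₁ > (0:ℝ), ∃ K₁ > (0:ℝ), ∃ Λ₀ : ℕ, ∃ θ₀ > (0:ℝ), ∃ C₁ > (0:ℝ), ∃ σ₁ > (0:ℝ),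
        ∀ E : Literature.Analysis.FluidPDE.LatticeShear.LagrangianLatticeCarrier k, E.design = W.stretch M hM → E.gain = c → E.nu0 = ν₁ → E.K = K₁ → E.LPermissible → E.Regular → (∀ m, Λ₀ * E.N m ≤ E.N (m + 1)) → (∀ m, E.N m ^ 2 ≤ E.N (m + 1)) → (∀ m, E.cellVisc (m + 1) * ((E.N (m + 1) : ℝ) / E.N m) ^ (1 / 4 : ℝ) ≤ 1) → (∀ m, E.K * ((E.N (m + 1) : ℝ) / E.N m) ^ (1 / 4 : ℝ) ≤ ((E.N (m + 1) : ℝ) / E.N m) * E.cellVisc (m + 1)) → (∀ m, E.θ (m + 1) * ((E.N (m + 1) : ℝ) / E.N m) ^ (1 / 16 : ℝ) ≤ θ₀) → (∀ m, ((E.N (m + 1) : ℝ) / E.N m) ^ (1 / 16 : ℝ) * E.physPeriod (m + 1) ≤ E.refresh (m + 1)) →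
        ∀ R : ℝ≥0, ∃ mstar : ℕ, ∀ m, mstar ≤ m →
          ∀ S : Torus.Visc4 (Fin 3), Torus.OddSmall S β → Torus.NearIso S lo hi →
            Torus.OddSmall (Φ (E.cellVisc (m + 1)) S) β → Torus.NearIso (Φ (E.cellVisc (m + 1)) S) lo hi →
          ∀ (w₀ : VF), IsDatum w₀ → InClass R w₀ →
          ∀ u v : ℝ → VF, TSol E (m + 1) (E.kbar (m + 1) • S) w₀ u →
            TSol E m (E.kbar m • renormStep (Φ (E.cellVisc (m + 1))) (E.gain / E.cellVisc (m + 1) ^ 2) S) w₀ v →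
            ∀ᵐ t ∂(volume.restrict (Ioo (1/2 : ℝ) 1)),
              (1 - C₁ * ((E.N m : ℝ) / E.N (m + 1)) ^ σ₁) * drop w₀ v t ≤ drop w₀ u t) :
    ∀ k (W : Literature.Analysis.FluidPDE.LatticeShear.LatticeWord k) (M : ℝ) (hM : 0 < M) (c : ℝ), 0 < c →
    ∀ (Φ : ℝ → Torus.Visc4 (Fin 3) → Torus.Visc4 (Fin 3)) (μ : ℝ → ℝ) (Sstar : Torus.Visc4 (Fin 3))
      (slo shi lam₀ Λ Λc Λ' lo hi ΛV β σ C ν₀ K Cf νf Kf : ℝ),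
      0 < lo → lo ≤ 1 → 1 ≤ hi → 1 < ΛV → 0 ≤ β → IntervalWindowFamily Φ μ Sstar slo shi lam₀ Λ Λc Λ' β lo hi ΛV →
      0 < σ → 0 ≤ C → 0 < ν₀ → 0 < K → SlowVectorClauseF W M hM c Φ lo hi ΛV β σ C ν₀ K →
      0 ≤ Cf → 0 < νf → 0 < Kf → CellEnergyClauses W M hM c lo hi ΛV β Cf νf Kf →
      ∃ ν₁ > (0:ℝ), ∃ K₁ > (0:ℝ), ∃ Λ₀ : ℕ, ∃ θ₀ > (0:ℝ),
        ∀ E : Literature.Analysis.FluidPDE.LatticeShear.LagrangianLatticeCarrier k, E.design = W.stretch M hM → E.gain = c → E.nu0 = ν₁ → E.K = K₁ → E.LPermissible → E.Regular → (∀ m, Λ₀ * E.N m ≤ E.N (m + 1)) → (∀ m, E.N m ^ 2 ≤ E.N (m + 1)) → (∀ m, E.cellVisc (m + 1) * ((E.N (m + 1) : ℝ) / E.N m) ^ (1 / 4 : ℝ) ≤ 1) → (∀ m, E.K * ((E.N (m + 1) : ℝ) / E.N m) ^ (1 / 4 : ℝ) ≤ ((E.N (m + 1) : ℝ) / E.N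 m) * E.cellVisc (m + 1)) → (∀ m, E.θ (m + 1) * ((E.N (m + 1) : ℝ) / E.N m) ^ (1 / 16 : ℝ) ≤ θ₀) → (∀ m, ((E.N (m + 1) : ℝ) / E.N m) ^ (1 / 16 : ℝ) * E.physPeriod (m + 1) ≤ E.refresh (m + 1)) → ChainLower E := by
  intro k W M hM c hc Φ μ Sstar slo shi lam₀ Λ Λc Λ' lo hi ΛV β σ C ν₀ K Cf νf Kf hlo hlo1 hhi1 hΛV hβ hWF hσ hC hν₀ hK hV hCf hνf hKf hEcl
  obtain ⟨ν₁, hν₁, K₁, hK₁, Λ₀, θ₀, hθ₀, C₁, hC₁, σ₁, hσ₁, hlev⟩ :=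
    hone k W M hM c hc Φ lo hi ΛV β σ C ν₀ K Cf νf Kf hlo hlo1 hhi1 hΛV hβ hσ hC hν₀ hK hV hCf hνf hKf hEcl
  refine ⟨ν₁, hν₁, K₁, hK₁, Λ₀, θ₀, hθ₀, ?_⟩
  intro E hW hg hn hK' hP hR h1a h1b h2 h3 h4 h5
  have hlevE := hlev E hW hg hn hK' hP hR h1a h1b h2 h3 h4 h5
  obtain ⟨hwin, hμ, htailB, hslo, hlamc, hΛcΛ, hloc, hhic, _, _, _⟩ := hWF
  obtain ⟨m₁, htail⟩ := htailB k E hP h1b h2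
  have hwinT : ∀ j m, m₁ ≤ m → m ≤ j → Torus.NearIso (chainTensorF E Φ j m) (E.kbar m * lo) (E.kbar m * hi) :=
    fun j m hm hmj => (chainTensorF_nearIso E hβ hslo.le hwin hμ hΛcΛ hlo.le hloc hhic htail hm hmj).2
  refine ⟨lo, hlo, hi, C₁, hC₁, σ₁, hσ₁, ?_⟩
  intro R
  obtain ⟨mstar, hm⟩ := hlevE R
  refine ⟨max mstar m₁, fun j hj => ⟨chainTensorF E Φ j, chainTensorF_top E Φ j,
    fun m hm1 hm2 => hwinT j m ((le_max_right _ _).trans hm1) hm2, ?_⟩⟩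
  intro m hm1 hm2 w₀ hdat hcl
  have hm1' : m₁ ≤ m := (le_max_right _ _).trans hm1
  have hm1'' : mstar ≤ m := (le_max_left _ _).trans hm1
  -- the level-(m+1) shape and its image through `Φ (cellVisc (m+1))`
  obtain ⟨⟨hSo, hSn⟩, _⟩ := chainTensorF_nearIso E hβ hslo.le hwin hμ hΛcΛ hlo.le hloc hhic htail
    (show m₁ ≤ m + 1 by omega) (show m + 1 ≤ j by omega)
  obtain ⟨hΦo, hΦn⟩ := chainImage_nearIso E hβ hslo.le hwin hμ hΛcΛ hlo.le hloc hhic htail hm1' hm2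
  have hstep := hm m hm1'' _ hSo hSn hΦo hΦn w₀ hdat hcl
  refine ⟨existsL_tensor E hR m (hwinT j m hm1' hm2.le) (mul_pos (E.kbar_pos m) hlo) w₀ hdat, ?_⟩
  intro u v hu hv
  have hv' := hv
  rw [chainTensorF_succ E Φ hm2] at hv'
  have hu' : TSol E (m + 1) (E.kbar (m + 1) • shapeSeqF (fun i => Φ (E.cellVisc i)) (fun i => E.gain / E.cellVisc i ^ 2) j (j - (m + 1))) w₀ u := hu
  have hcmp := hstep u v hu' hv'
  have hbase := hba k E hP hR m (chainTensorF E Φ j m) (E.kbar m * lo) (E.kbar m * hi)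
    (mul_pos (E.kbar_pos m) hlo) (hwinT j m hm1' hm2.le) w₀ v hdat hv
  have hcb : 0 ≤ 1 - Real.exp (-(4 * Real.pi ^ 2 * (E.kbar m * lo))) := by
    have hexp : Real.exp (-(4 * Real.pi ^ 2 * (E.kbar m * lo))) < 1 := by
      rw [Real.exp_lt_one_iff]
      have : 0 < 4 * Real.pi ^ 2 * (E.kbar m * lo) := by
        have := E.kbar_pos m
        positivity
      linarith
    linarith
  have hL2 : 0 ≤ Torus.vectorL2Sq w₀ := by
    show 0 ≤ ∫ x, ‖w₀ x‖ ^ 2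
    exact integral_nonneg fun x => by positivity
  filter_upwards [hcmp, hbase] with t h1 h2
  exact ⟨le_trans (mul_nonneg hcb hL2) h2, h1⟩


/-! ## §6 AMENDMENT 1 — the SECTORIAL odd guard (answer to p5 `STUB-IDEAS-stub_cellLawV-p5` §7 (b), STATUS 12:21:30Z)

p5's catch: the window's odd half `OddSmall S β → OddSmall (Φν S) β` with the SAME ABSOLUTE `β` fights the degree-(−1) homogeneity of the
quasi-static response — the absolute odd gain at `S = bI` is `κ_odd(bI) = γ_W/b²`, so over a band reaching down to `b = lo/Λ` the clause needs
`γ_W·Λ²/lo² < 1` (her `a⋆(W)·γ_W < 1`, a CLASS condition on the word), although `γ_W < 1` holds for every isotropic word (`OddChannelAMGM`).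
THE FIX TYPED HERE: guard the odd part RELATIVE TO THE LOCAL EVEN SYMBOL — the Kato-sector condition
`(β_S(k;p,q) − β_S(k;q,p))² ≤ τ²·σ_S(k,p)·σ_S(k,q)` (`OddSectorial S τ`; numerical range of every transverse block in the sector `|Im| ≤ τ·Re`).
It is (1) invariant under `S ↦ c•S` (`OddSectorial.smul`, any real `c` — the `ν·β` bookkeeping of (V)/F2 disappears), (2) closed under sums of
transversally nonnegative tensors (Cauchy–Schwarz, `OddSectorial.add`) hence under `renormStep`, (3) EXACTLY preserved by inversion of blocks
(`sector_inv`: `W(B⁻¹) = conj W(B)` up to positive scaling — the certificate that a degree-(−1) response does NOT amplify the sector: the sectorial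
odd gain is `γ_W` UNIFORMLY on the ray, = the absolute gain at the fixed point), (4) convertible both ways against `NearIso`:
`OddSectorial τ ∧ NearIso lo hi ⇒ OddSmall (τ·hi)` and `OddSmall β ∧ NearIso lo hi ⇒ OddSectorial (β/lo)` — so EVERY downstream text ((V), (T),
the window-agnostic `stub_oneLevelL_I`) keeps its absolute `OddSmall`, only the WINDOW changes: `SectorialWindowClause Φ lo hi Λ τlo τhi` (= the
tree's `WindowClause` with `OddSmall S β ↦ OddSectorial S τ`, for every sector `τ ∈ [τlo, τhi]`).  Consumer facts re-proved below for the ν-family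
(`shapeSeqF_sectorialWindow`, `chainTensorF_sectorial`, `nearIso_effTensorS`, `exists_effective_singleModeS`, `slowVectorClauseF_of_noExF_sectorial`)
and the glue `chainLower_of_pieces_S` (PROVED) with the UNCHANGED `stub_oneLevelL_I`; bookkeeping: `τc ∈ [τlo, τhi]`, `τc·hi ≤ β` (chain → (V)'s β),
`β·Λ/lo ∈ [τlo, τhi]` (F2).  Model side (not here): sector non-expansion `OddSectorial S τ → OddSectorial (Φν S) τ` for `τ ∈ [τlo, τhi]` should follow
from slot compression + congruence + positive sums (all sector-preserving: sectors are convex cones) + `sector_inv` + the saturation defect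
`‖e^{−TB}‖ ≤ e^{−T·min σ(B_s)}` (Lumer–Phillips, independent of the odd part) + the additive mixing remainder `|R_ν| ≤ e^{−1.1·10⁵M}` which fixes
`τlo ≈ e^{−1.1·10⁵M}/((1−γ_W)·lo)`; p5's class condition `a⋆(W)·γ_W < 1` relaxes to `sup_window γ^{sect} < 1` (on the isotropic ray exactly `γ_W < 1`,
every isotropic word).  CHEAPEST FALSIFIER: p5's odd-channel engine (j308312) evaluated in sectorial normalisation at the anisotropic band points.
-/

/-- **SECTORIAL ODD-PART BOUND** (Kato sector of half-angle `arctan τ` for every transverse block): the antisymmetric part of the transverse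
bilinear symbol is at most `τ` times the GEOMETRIC MEAN of the even symbol at `p` and at `q`.  Scale-invariant, unlike `OddSmall`. -/
def OddSectorial (S : T4) (τ : ℝ) : Prop :=
  ∀ k p q : Fin 3 → ℝ, ∑ i, p i * k i = 0 → ∑ i, q i * k i = 0 →
    (Torus.bsymb S k p q - Torus.bsymb S k q p) ^ 2 ≤ τ ^ 2 * (Torus.symb S k p * Torus.symb S k q)

/-- The real-number core of `OddSectorial.add`: two sectorial forms add (Cauchy–Schwarz / AM–GM on the cross term). -/
theorem sector_add_aux {x y a₁ a₂ b₁ b₂ τ : ℝ} (ha₁ : 0 ≤ a₁) (ha₂ : 0 ≤ a₂) (hb₁ : 0 ≤ b₁) (hb₂ : 0 ≤ b₂)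
    (h₁ : x ^ 2 ≤ τ ^ 2 * (a₁ * a₂)) (h₂ : y ^ 2 ≤ τ ^ 2 * (b₁ * b₂)) :
    (x + y) ^ 2 ≤ τ ^ 2 * ((a₁ + b₁) * (a₂ + b₂)) := by
  have hM : 0 ≤ τ ^ 2 * (a₁ * b₂ + a₂ * b₁) := mul_nonneg (sq_nonneg τ) (add_nonneg (mul_nonneg ha₁ hb₂) (mul_nonneg ha₂ hb₁))
  have hsq : (2 * (x * y)) ^ 2 ≤ (τ ^ 2 * (a₁ * b₂ + a₂ * b₁)) ^ 2 := by
    have hprod : x ^ 2 * y ^ 2 ≤ (τ ^ 2 * (a₁ * a₂)) * (τ ^ 2 * (b₁ * b₂)) :=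
      mul_le_mul h₁ h₂ (sq_nonneg _) (mul_nonneg (sq_nonneg τ) (mul_nonneg ha₁ ha₂))
    have hamgm : 4 * ((a₁ * a₂) * (b₁ * b₂)) ≤ (a₁ * b₂ + a₂ * b₁) ^ 2 := by
      nlinarith [sq_nonneg (a₁ * b₂ - a₂ * b₁)]
    have hτ4 : 0 ≤ (τ ^ 2) ^ 2 := sq_nonneg _
    calc (2 * (x * y)) ^ 2 = 4 * (x ^ 2 * y ^ 2) := by ring
      _ ≤ 4 * ((τ ^ 2 * (a₁ * a₂)) * (τ ^ 2 * (b₁ * b₂))) := by linarith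
      _ = (τ ^ 2) ^ 2 * (4 * ((a₁ * a₂) * (b₁ * b₂))) := by ring
      _ ≤ (τ ^ 2) ^ 2 * (a₁ * b₂ + a₂ * b₁) ^ 2 := mul_le_mul_of_nonneg_left hamgm hτ4
      _ = (τ ^ 2 * (a₁ * b₂ + a₂ * b₁)) ^ 2 := by ring
  have hcross : 2 * (x * y) ≤ τ ^ 2 * (a₁ * b₂ + a₂ * b₁) := (abs_le_of_sq_le_sq' hsq hM).2
  calc (x + y) ^ 2 = x ^ 2 + y ^ 2 + 2 * (x * y) := by ring
    _ ≤ τ ^ 2 * (a₁ * a₂) + τ ^ 2 * (b₁ * b₂) + τ ^ 2 * (a₁ * b₂ + a₂ * b₁) := by linarith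
    _ = τ ^ 2 * ((a₁ + b₁) * (a₂ + b₂)) := by ring

/-- SCALE INVARIANCE: the sector is kept by EVERY real multiple (both sides scale by `c²`). -/
theorem OddSectorial.smul {S : T4} {τ : ℝ} (h : OddSectorial S τ) (c : ℝ) : OddSectorial (c • S) τ := by
  intro k p q hp hq
  have h' := h k p q hp hq
  rw [Torus.bsymb_smul, Torus.bsymb_smul, Torus.symb_smul, Torus.symb_smul]
  calc (c * Torus.bsymb S k p q - c * Torus.bsymb S k q p) ^ 2 = c ^ 2 * (Torus.bsymb S k p q - Torus.bsymb S k q p) ^ 2 := by ring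
    _ ≤ c ^ 2 * (τ ^ 2 * (Torus.symb S k p * Torus.symb S k q)) := mul_le_mul_of_nonneg_left h' (sq_nonneg c)
    _ = τ ^ 2 * (c * Torus.symb S k p * (c * Torus.symb S k q)) := by ring

/-- … so the `ν`-scaling of the cell laws costs nothing: `OddSectorial ((1/ν)•𝔸) τ ↔ OddSectorial 𝔸 τ`. -/
theorem oddSectorial_smul_iff {S : T4} {τ c : ℝ} (hc : c ≠ 0) : OddSectorial (c • S) τ ↔ OddSectorial S τ := by
  refine ⟨fun h => ?_, fun h => h.smul c⟩
  have h' := h.smul c⁻¹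
  rwa [smul_smul, inv_mul_cancel₀ hc, one_smul] at h'

theorem TransNonneg.smul {S : T4} (h : TransNonneg S) {c : ℝ} (hc : 0 ≤ c) : TransNonneg (c • S) := by
  intro k p hkp
  rw [Torus.symb_smul]
  exact mul_nonneg hc (h k p hkp)

theorem TransNonneg.add {A B : T4} (hA : TransNonneg A) (hB : TransNonneg B) : TransNonneg (A + B) := by
  intro k p hkp
  rw [Torus.symb_add]
  exact add_nonneg (hA k p hkp) (hB k p hkp)

/-- The sector widens monotonically in `τ ≥ 0` (transversally nonnegative tensors). -/
theorem OddSectorial.mono {S : T4} {τ τ' : ℝ} (h : OddSectorial S τ) (hpos : TransNonneg S) (hτ : 0 ≤ τ) (hle : τ ≤ τ') :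
    OddSectorial S τ' := by
  intro k p q hp hq
  refine (h k p q hp hq).trans (mul_le_mul_of_nonneg_right (pow_le_pow_left₀ hτ hle 2) ?_)
  exact mul_nonneg (hpos k p hp) (hpos k q hq)

/-- SUMS: two transversally nonnegative tensors in the sector `τ` add to a tensor in the sector `τ` (sectors are convex cones). -/
theorem OddSectorial.add {A B : T4} {τ : ℝ} (hA : OddSectorial A τ) (hB : OddSectorial B τ)
    (hApos : TransNonneg A) (hBpos : TransNonneg B) : OddSectorial (A + B) τ := by
  intro k p q hp hq
  rw [Torus.bsymb_add, Torus.bsymb_add, Torus.symb_add, Torus.symb_add]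
  have e : Torus.bsymb A k p q + Torus.bsymb B k p q - (Torus.bsymb A k q p + Torus.bsymb B k q p) =
      (Torus.bsymb A k p q - Torus.bsymb A k q p) + (Torus.bsymb B k p q - Torus.bsymb B k q p) := by ring
  rw [e]
  exact sector_add_aux (hApos k p hp) (hApos k q hq) (hBpos k p hp) (hBpos k q hq) (hA k p q hp hq) (hB k p q hp hq)

/-- The scalar viscosity has no odd part: it lies in every sector. -/
theorem oddSectorial_isoVisc (ν τ : ℝ) : OddSectorial (Torus.isoVisc ν : T4) τ := by
  intro k p q hp hq
  have hpq : ∑ i, p i * q i = ∑ i, q i * p i := Finset.sum_congr rfl fun i _ => mul_comm _ _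
  rw [Torus.bsymb_isoVisc, Torus.bsymb_isoVisc, hpq, sub_self, Torus.symb_isoVisc, Torus.symb_isoVisc]
  have : 0 ≤ τ ^ 2 * (ν * ((∑ a, k a ^ 2) * ∑ i, p i ^ 2) * (ν * ((∑ a, k a ^ 2) * ∑ i, q i ^ 2))) := by
    have h0 : 0 ≤ ν * ((∑ a, k a ^ 2) * ∑ i, p i ^ 2) * (ν * ((∑ a, k a ^ 2) * ∑ i, q i ^ 2)) := by
      have : ν * ((∑ a, k a ^ 2) * ∑ i, p i ^ 2) * (ν * ((∑ a, k a ^ 2) * ∑ i, q i ^ 2)) =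
          ν ^ 2 * (((∑ a, k a ^ 2) * ∑ i, p i ^ 2) * ((∑ a, k a ^ 2) * ∑ i, q i ^ 2)) := by ring
      rw [this]; positivity
    exact mul_nonneg (sq_nonneg τ) h0
  simpa using this

/-- `renormStep` keeps the sector (convex combination of two transversally nonnegative tensors in the sector). -/
theorem oddSectorial_renormStep {Φν : T4 → T4} {τ g : ℝ} (hg : 0 ≤ g) {S : T4}
    (hSpos : TransNonneg S) (hΦpos : TransNonneg (Φν S)) (hS : OddSectorial S τ) (hΦ : OddSectorial (Φν S) τ) :
    OddSectorial (renormStep Φν g S) τ :=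
  ((hS.add (hΦ.smul g) hSpos (hΦpos.smul hg))).smul (1 / (1 + g))

/-- CONVERSION sector → absolute: `OddSectorial τ ∧ NearIso lo hi` (`lo ≥ 0`, `τ ≥ 0`) gives `OddSmall (τ·hi)` — how the chain feeds the
UNCHANGED absolute `OddSmall S β` hypotheses of `stub_oneLevelL_I` / (V). -/
theorem OddSectorial.oddSmall {S : T4} {τ lo hi : ℝ} (h : OddSectorial S τ) (hn : Torus.NearIso S lo hi) (hlo : 0 ≤ lo) (hτ : 0 ≤ τ) :
    Torus.OddSmall S (τ * hi) := by
  intro k p q hp hq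
  obtain ⟨hlp, hhp⟩ := hn k p hp
  obtain ⟨hlq, hhq⟩ := hn k q hq
  have hQp : 0 ≤ (∑ a, k a ^ 2) * (∑ i, p i ^ 2) := by positivity
  have hQq : 0 ≤ (∑ a, k a ^ 2) * (∑ i, q i ^ 2) := by positivity
  have hσp : 0 ≤ Torus.symb S k p := le_trans (mul_nonneg hlo hQp) hlp
  have hσq : 0 ≤ Torus.symb S k q := le_trans (mul_nonneg hlo hQq) hlq
  have hHp : 0 ≤ hi * ((∑ a, k a ^ 2) * (∑ i, p i ^ 2)) := hσp.trans hhp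
  calc (Torus.bsymb S k p q - Torus.bsymb S k q p) ^ 2 ≤ τ ^ 2 * (Torus.symb S k p * Torus.symb S k q) := h k p q hp hq
    _ ≤ τ ^ 2 * ((hi * ((∑ a, k a ^ 2) * (∑ i, p i ^ 2))) * (hi * ((∑ a, k a ^ 2) * (∑ i, q i ^ 2)))) :=
        mul_le_mul_of_nonneg_left (mul_le_mul hhp hhq hσq hHp) (sq_nonneg τ)
    _ = (τ * hi) ^ 2 * ((∑ a, k a ^ 2) ^ 2 * ((∑ i, p i ^ 2) * (∑ i, q i ^ 2))) := by ring

/-- CONVERSION absolute → sector: `OddSmall β ∧ NearIso lo hi` (`lo > 0`) gives `OddSectorial (β/lo)` — how F2 feeds (V)'s absolute hypothesis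
`OddSmall 𝔸 (ν·β)` into the sectorial window. -/
theorem oddSectorial_of_oddSmall {S : T4} {β lo hi : ℝ} (h : Torus.OddSmall S β) (hn : Torus.NearIso S lo hi) (hlo : 0 < lo) :
    OddSectorial S (β / lo) := by
  intro k p q hp hq
  obtain ⟨hlp, _⟩ := hn k p hp
  obtain ⟨hlq, _⟩ := hn k q hq
  have hQp : 0 ≤ (∑ a, k a ^ 2) * (∑ i, p i ^ 2) := by positivity
  have hQq : 0 ≤ (∑ a, k a ^ 2) * (∑ i, q i ^ 2) := by positivity
  have hlo0 : lo ≠ 0 := hlo.ne'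
  calc (Torus.bsymb S k p q - Torus.bsymb S k q p) ^ 2 ≤ β ^ 2 * ((∑ a, k a ^ 2) ^ 2 * ((∑ i, p i ^ 2) * (∑ i, q i ^ 2))) := h k p q hp hq
    _ = (β / lo) ^ 2 * ((lo * ((∑ a, k a ^ 2) * (∑ i, p i ^ 2))) * (lo * ((∑ a, k a ^ 2) * (∑ i, q i ^ 2)))) := by
        field_simp
    _ ≤ (β / lo) ^ 2 * (Torus.symb S k p * Torus.symb S k q) :=
        mul_le_mul_of_nonneg_left (mul_le_mul hlp hlq (mul_nonneg hlo.le hQq) (le_trans (mul_nonneg hlo.le hQp) hlp)) (sq_nonneg _)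

/-- **THE CERTIFICATE OF THE LEVER (finite-dimensional core): INVERSION PRESERVES THE SECTOR EXACTLY.**  For an invertible real matrix `B`,
the sector condition `(xᵀBy − yᵀBx)² ≤ τ²(xᵀBx)(yᵀBy)` (all `x, y`) passes to `B⁻¹` with the SAME `τ` (substitute `x = Bx₀`, `y = By₀`:
`xᵀB⁻¹y = y₀ᵀBx₀`, `xᵀB⁻¹x = x₀ᵀBx₀`; Kato: `W(B⁻¹) = conj W(B)` up to positive scaling).  A degree-(−1) slot response therefore does NOT amplify
the sectorial odd part — contrast the absolute gain `γ_W/b²`. [folklore; Kato, Perturbation Theory, V §3.10] -/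
theorem sector_inv {n : ℕ} (B : Matrix (Fin n) (Fin n) ℝ) (hB : IsUnit B.det) {τ : ℝ}
    (h : ∀ x y : Fin n → ℝ, (x ⬝ᵥ B.mulVec y - y ⬝ᵥ B.mulVec x) ^ 2 ≤ τ ^ 2 * ((x ⬝ᵥ B.mulVec x) * (y ⬝ᵥ B.mulVec y))) :
    ∀ x y : Fin n → ℝ, (x ⬝ᵥ B⁻¹.mulVec y - y ⬝ᵥ B⁻¹.mulVec x) ^ 2 ≤ τ ^ 2 * ((x ⬝ᵥ B⁻¹.mulVec x) * (y ⬝ᵥ B⁻¹.mulVec y)) := by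
  intro x y
  set x₀ : Fin n → ℝ := B⁻¹.mulVec x with hx₀
  set y₀ : Fin n → ℝ := B⁻¹.mulVec y with hy₀
  have hx : B.mulVec x₀ = x := by rw [hx₀, Matrix.mulVec_mulVec, Matrix.mul_nonsing_inv _ hB, Matrix.one_mulVec]
  have hy : B.mulVec y₀ = y := by rw [hy₀, Matrix.mulVec_mulVec, Matrix.mul_nonsing_inv _ hB, Matrix.one_mulVec]
  have e1 : x ⬝ᵥ y₀ = y₀ ⬝ᵥ B.mulVec x₀ := by rw [← hx, dotProduct_comm]
  have e2 : y ⬝ᵥ x₀ = x₀ ⬝ᵥ B.mulVec y₀ := by rw [← hy, dotProduct_comm]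
  have e3 : x ⬝ᵥ x₀ = x₀ ⬝ᵥ B.mulVec x₀ := by rw [← hx, dotProduct_comm]
  have e4 : y ⬝ᵥ y₀ = y₀ ⬝ᵥ B.mulVec y₀ := by rw [← hy, dotProduct_comm]
  rw [e1, e2, e3, e4]
  calc (y₀ ⬝ᵥ B.mulVec x₀ - x₀ ⬝ᵥ B.mulVec y₀) ^ 2 = (x₀ ⬝ᵥ B.mulVec y₀ - y₀ ⬝ᵥ B.mulVec x₀) ^ 2 := by ring
    _ ≤ τ ^ 2 * ((x₀ ⬝ᵥ B.mulVec x₀) * (y₀ ⬝ᵥ B.mulVec y₀)) := h x₀ y₀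

/-! ### The sectorial window clauses and their consumer facts (I-centred band = the tree's `WindowClause` shape, p1's v22) -/

/-- **SECTORIAL WINDOW CLAUSE** (I-centred): the tree's `WindowClause Φ lo hi Λ β` with the absolute odd guard replaced by the sector, for
every half-angle `τ ∈ [τlo, τhi]`.  Family use: `∀ ν, SectorialWindowClause (Φ ν) lo hi Λ τlo τhi`. -/
def SectorialWindowClause (Φν : T4 → T4) (lo hi Λ τlo τhi : ℝ) : Prop :=
  ∀ τ ∈ Set.Icc τlo τhi, ∀ lam ∈ Set.Icc (1:ℝ) Λ, ∀ S : T4, OddSectorial S τ → Torus.NearIso S (lo / lam) (hi * lam) →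
    OddSectorial (Φν S) τ ∧ Torus.NearIso (Φν S) (lo / lam) (hi * lam)

/-- **SECTORIAL INTERVAL WINDOW CLAUSE** (S⋆-centred; §2 with the sector in place of `OddSmall`): both guards are scale-free cones — a Thompson
ball for the even part, a Kato sector for the odd part.  (§3–§5 transfer verbatim with `OddSmall β ↦ OddSectorial τ` and the conversion
`OddSectorial.oddSmall`; not re-proved here.) -/
def SectorialIntervalWindowClause (Φν : T4 → T4) (Sstar : T4) (slo shi lam₀ Λ τlo τhi μ : ℝ) : Prop :=
  Torus.NearIso Sstar slo shi ∧ 1 ≤ lam₀ ∧ InInterval Sstar lam₀ (Torus.isoVisc 1) ∧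
  ∀ τ ∈ Set.Icc τlo τhi, ∀ lam ∈ Set.Icc lam₀ Λ, ∀ S : T4, OddSectorial S τ → InInterval Sstar lam S →
    OddSectorial (Φν S) τ ∧ InInterval Sstar (μ * lam) (Φν S)

/-- The clause at `λ = 1`. -/
theorem sectorialWindow_one {Φν : T4 → T4} {lo hi Λ τlo τhi τ : ℝ} (hwin : SectorialWindowClause Φν lo hi Λ τlo τhi) (hΛ : 1 ≤ Λ)
    (hτ : τ ∈ Set.Icc τlo τhi) {S : T4} (hSo : OddSectorial S τ) (hSn : Torus.NearIso S lo hi) :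
    OddSectorial (Φν S) τ ∧ Torus.NearIso (Φν S) lo hi := by
  have h1 : (1:ℝ) ∈ Set.Icc (1:ℝ) Λ := ⟨le_rfl, hΛ⟩
  obtain ⟨ho, hn⟩ := hwin τ hτ 1 h1 S hSo (by simpa using hSn)
  exact ⟨ho, by simpa using hn⟩

/-- Every shape of the family chain stays in the sector `τ` and in the band `[lo, hi]` (`shapeSeq_window` with the sectorial guard). -/
theorem shapeSeqF_sectorialWindow {Ψ : ℕ → T4 → T4} {lo hi Λ τlo τhi τ : ℝ} (hlo : 0 ≤ lo) (hlo1 : lo ≤ 1) (hhi1 : 1 ≤ hi) (hΛ : 1 ≤ Λ)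
    (hτ : τ ∈ Set.Icc τlo τhi) (hwin : ∀ i, SectorialWindowClause (Ψ i) lo hi Λ τlo τhi) {g : ℕ → ℝ} (hg : ∀ i, 0 ≤ g i) (j : ℕ) :
    ∀ d, OddSectorial (shapeSeqF Ψ g j d) τ ∧ Torus.NearIso (shapeSeqF Ψ g j d) lo hi
  | 0 => ⟨oddSectorial_isoVisc 1 τ, (Torus.nearIso_isoVisc 1).mono hlo1 hhi1⟩
  | d + 1 => by
      obtain ⟨ho, hn⟩ := shapeSeqF_sectorialWindow hlo hlo1 hhi1 hΛ hτ hwin hg j d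
      obtain ⟨hΦo, hΦn⟩ := sectorialWindow_one (hwin (j - d)) hΛ hτ ho hn
      exact ⟨oddSectorial_renormStep (hg _) (transNonneg_of_nearIso hn hlo) (transNonneg_of_nearIso hΦn hlo) ho hΦo,
        nearIso_renormStep (hg _) hn hΦn⟩

/-- **CONSUMER FACT 1 (chain), sectorial window.**  For every `j m`: the level-`(m+1)`… shapes and their images are `OddSmall (τc·hi) ∧ NearIso lo hi`
(ABSOLUTE, as `stub_oneLevelL_I` wants them) and `NearIso (chainTensorF E Φ j m) (kbar m·lo) (kbar m·hi)`. -/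
theorem chainTensorF_sectorial {k : ℕ} (E : LatticeShear.LagrangianLatticeCarrier k) {Φ : ℝ → T4 → T4} {lo hi Λ τlo τhi τc : ℝ}
    (hlo : 0 ≤ lo) (hlo1 : lo ≤ 1) (hhi1 : 1 ≤ hi) (hΛ : 1 ≤ Λ) (hτ : τc ∈ Set.Icc τlo τhi) (hτ0 : 0 ≤ τc)
    (hwin : ∀ ν, SectorialWindowClause (Φ ν) lo hi Λ τlo τhi) (j m : ℕ) :
    (Torus.OddSmall (shapeSeqF (fun i => Φ (E.cellVisc i)) (fun i => E.gain / E.cellVisc i ^ 2) j (j - m)) (τc * hi) ∧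
      Torus.NearIso (shapeSeqF (fun i => Φ (E.cellVisc i)) (fun i => E.gain / E.cellVisc i ^ 2) j (j - m)) lo hi) ∧
    (Torus.OddSmall (Φ (E.cellVisc (m + 1)) (shapeSeqF (fun i => Φ (E.cellVisc i)) (fun i => E.gain / E.cellVisc i ^ 2) j (j - (m + 1)))) (τc * hi) ∧
      Torus.NearIso (Φ (E.cellVisc (m + 1)) (shapeSeqF (fun i => Φ (E.cellVisc i)) (fun i => E.gain / E.cellVisc i ^ 2) j (j - (m + 1)))) lo hi) ∧
    Torus.NearIso (chainTensorF E Φ j m) (E.kbar m * lo) (E.kbar m * hi) := by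
  have hwin' : ∀ i, SectorialWindowClause (Φ (E.cellVisc i)) lo hi Λ τlo τhi := fun i => hwin _
  have hgpos : ∀ i, 0 ≤ E.gain / E.cellVisc i ^ 2 := fun i => div_nonneg E.gain_pos.le (sq_nonneg _)
  have hS := shapeSeqF_sectorialWindow hlo hlo1 hhi1 hΛ hτ hwin' hgpos j
  obtain ⟨ho, hn⟩ := hS (j - m)
  obtain ⟨ho', hn'⟩ := hS (j - (m + 1))
  obtain ⟨hΦo, hΦn⟩ := sectorialWindow_one (hwin (E.cellVisc (m + 1))) hΛ hτ ho' hn'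
  exact ⟨⟨ho.oddSmall hn hlo hτ0, hn⟩, ⟨hΦo.oddSmall hΦn hlo hτ0, hΦn⟩, hn.smul (E.kbar_pos m).le⟩

/-- **CONSUMER FACT 2 (F2), sectorial window: ellipticity of the effective tensor.**  (V)'s ABSOLUTE hypothesis `OddSmall 𝔸 (ν·β)` is converted
to the sector `β·Λ/lo` (`oddSectorial_of_oddSmall` + monotonicity), at which the clause fires. -/
theorem nearIso_effTensorS {Φν : T4 → T4} {lo hi Λ τlo τhi β : ℝ} (hwin : SectorialWindowClause Φν lo hi Λ τlo τhi) (hlo : 0 < lo)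
    (hβ : 0 ≤ β) (hτ : β * Λ / lo ∈ Set.Icc τlo τhi) {ν c : ℝ} (hν : 0 < ν) (hc : 0 ≤ c) {n : ℕ} {𝔸 : T4}
    (hodd : Torus.OddSmall 𝔸 (ν * β)) {lam : ℝ} (hlam : lam ∈ Set.Icc (1:ℝ) Λ)
    (hA : Torus.NearIso 𝔸 (ν * (lo / lam)) (ν * (hi * lam))) :
    Torus.NearIso ((1 / (n:ℝ) ^ 2) • (𝔸 + (c / ν) • Φν ((1 / ν) • 𝔸)))
      ((1 / (n:ℝ) ^ 2) * ((ν + c / ν) * (lo / lam))) ((1 / (n:ℝ) ^ 2) * ((ν + c / ν) * (hi * lam))) := by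
  have hν0 : ν ≠ 0 := hν.ne'
  have hlam0 : 0 < lam := lt_of_lt_of_le one_pos hlam.1
  have hodd' : Torus.OddSmall ((1 / ν) • 𝔸) β := by
    have h := hodd.smul (1 / ν)
    exact oddSmall_congr h (by field_simp)
  have hA' : Torus.NearIso ((1 / ν) • 𝔸) (lo / lam) (hi * lam) := by
    have h := hA.smul (c := 1 / ν) (by positivity)
    exact nearIso_congr h (by field_simp) (by field_simp)
  have hsec : OddSectorial ((1 / ν) • 𝔸) (β * Λ / lo) := by
    have h0 := oddSectorial_of_oddSmall hodd' hA' (div_pos hlo hlam0)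
    refine h0.mono (transNonneg_of_nearIso hA' (div_nonneg hlo.le hlam0.le)) (div_nonneg hβ (div_nonneg hlo.le hlam0.le)) ?_
    rw [div_div_eq_mul_div, div_le_div_iff_of_pos_right hlo]
    exact mul_le_mul_of_nonneg_left hlam.2 hβ
  obtain ⟨_, hΦ⟩ := hwin _ hτ lam hlam _ hsec hA'
  have hcν : 0 ≤ c / ν := div_nonneg hc hν.le
  have hsum := hA.add (hΦ.smul hcν)
  have hn : (0:ℝ) ≤ 1 / (n:ℝ) ^ 2 := by positivity
  have h := hsum.smul hn
  exact nearIso_congr h (by ring) (by ring)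

/-- Existence of the effective single-mode solution, sectorial window (Lions). [cite: LionsMagenes1972, Chap. 3 Thm. 1.1] -/
theorem exists_effective_singleModeS {Φν : T4 → T4} {lo hi Λ τlo τhi β : ℝ} (hlo : 0 < lo)
    (hwin : SectorialWindowClause Φν lo hi Λ τlo τhi) (hβ : 0 ≤ β) (hτ : β * Λ / lo ∈ Set.Icc τlo τhi)
    {ν c K : ℝ} (hν : 0 < ν) (hc : 0 ≤ c) (hK : 0 < K) {n : ℕ}
    {𝔸 : T4} (hodd : Torus.OddSmall 𝔸 (ν * β))
    (hwin' : ∃ lam ∈ Set.Icc (1:ℝ) Λ, Torus.NearIso 𝔸 (ν * (lo / lam)) (ν * (hi * lam)))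
    {ℓ : Fin 3 → ℤ} (hℓ : ℓ ≠ 0) (hsep : ‖Torus.latticeVec ℓ‖ * (⌈K / ν⌉₊ : ℝ) ≤ n)
    {p : EuclideanSpace ℝ (Fin 3)} (hperp : ⟪p, Torus.latticeVec ℓ⟫_ℝ = 0) {T : ℝ} (hT : 0 < T) :
    ∃ v : ℝ → VF, Torus.IsWeakTensorPassiveVectorOn 0 (2 * T) ((1 / (n:ℝ) ^ 2) • (𝔸 + (c / ν) • Φν ((1 / ν) • 𝔸))) (fun _ _ => 0)
      (fun x => (UnitAddTorus.mFourier ℓ x).re • p) v := by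
  obtain ⟨lam, hlam, hA⟩ := hwin'
  have hN := nearIso_effTensorS (n := n) (c := c) hwin hlo hβ hτ hν hc hodd hlam hA
  have hn1 : 1 ≤ (n:ℝ) := one_le_of_slowBand hℓ hK hν hsep
  have hlam1 : 0 < lam := lt_of_lt_of_le one_pos hlam.1
  have hlo' : 0 < (1 / (n:ℝ) ^ 2) * ((ν + c / ν) * (lo / lam)) := by
    have : 0 < ν + c / ν := by positivity
    positivity
  exact FluidPDE.Torus.exists_isWeakTensorPassiveVectorOn_zero_carrier (by linarith) hN hlo'
    (memLp_two_of_memSobolev_one_complexify (memSobolev_one_singleMode ℓ p)) (isWeaklyDivFree_singleMode ℓ hperp)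

/-- **THE FAMILY ADAPTER (V_ν without existence ⇒ V_ν) from the SECTORIAL window** — (V)'s text byte-identical (absolute `OddSmall 𝔸 (ν·β)`). -/
theorem slowVectorClauseF_of_noExF_sectorial {k : ℕ} {W : LatticeShear.LatticeWord k} {M : ℝ} {hM : 0 < M} {c : ℝ}
    {Φ : ℝ → T4 → T4} {lo hi Λ τlo τhi β σ C ν₀ K : ℝ}
    (hc : 0 < c) (hlo : 0 < lo) (hK : 0 < K) (hwin : ∀ ν, SectorialWindowClause (Φ ν) lo hi Λ τlo τhi) (hβ : 0 ≤ β)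
    (hτ : β * Λ / lo ∈ Set.Icc τlo τhi)
    (h : SlowVectorClauseNoExF W M hM c Φ lo hi Λ β σ C ν₀ K) : SlowVectorClauseF W M hM c Φ lo hi Λ β σ C ν₀ K := by
  intro ν hν n 𝔸 hodd hwin' ℓ hℓ hsep p hp hperp T hT
  exact ⟨exists_effective_singleModeS hlo (hwin ν) hβ hτ hν.1 hc.le hK hodd hwin' hℓ hsep hperp hT,
    h ν hν n 𝔸 hodd hwin' ℓ hℓ hsep p hp hperp T hT⟩

/-- CANDIDATE v22-S text of the WINDOW+LAW stub: `stub_cellLawV` with `∀ ν, SectorialWindowClause (Φ ν) lo hi Λ τlo τhi` and the two sector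
bookkeeping facts (`τc` for the chain with `τc·hi ≤ β`; `β·Λ/lo` for F2).  Sorried ONLY to show it elaborates; not registered. -/
theorem stub_cellLawW_S : ∀ k (W : Literature.Analysis.FluidPDE.LatticeShear.LatticeWord k) (c₀ : ℝ), 0 < c₀ →
    Literature.Analysis.FluidPDE.LatticeShear.IsotropicWordGain W c₀ → ScalarLawBlock W c₀ →
    ∃ M : ℝ, ∃ hM : 0 < M, ∃ c > (0:ℝ), ∃ Φ : ℝ → Torus.Visc4 (Fin 3) → Torus.Visc4 (Fin 3),
      ∃ lo > (0:ℝ), ∃ hi : ℝ, lo ≤ 1 ∧ 1 ≤ hi ∧ ∃ Λ > (1:ℝ), ∃ β ≥ (0:ℝ), ∃ τlo τhi τc : ℝ,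
      (∀ ν, SectorialWindowClause (Φ ν) lo hi Λ τlo τhi) ∧ τc ∈ Set.Icc τlo τhi ∧ 0 ≤ τc ∧ τc * hi ≤ β ∧ β * Λ / lo ∈ Set.Icc τlo τhi ∧
      ∃ σ > (0:ℝ), ∃ C : ℝ, 0 ≤ C ∧ ∃ ν₀ > (0:ℝ), ∃ K > (0:ℝ), SlowVectorClauseNoExF W M hM c Φ lo hi Λ β σ C ν₀ K := by
  sorry

/-- **THE RE-PLUMBED GLUE FOR THE SECTORIAL WINDOW, PROVED** — `chainLower_of_pieces` (p629119) with the window hypothesis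
`∀ ν, SectorialWindowClause (Φ ν) lo hi Λ τlo τhi` + `τc ∈ [τlo, τhi]`, `0 ≤ τc`, `τc·hi ≤ β`, the one-level step being the UNCHANGED
window-agnostic `stub_oneLevelL_I` (fed `OddSmall … β` by `chainTensorF_sectorial` + `OddSmall.mono`). -/
theorem chainLower_of_pieces_S
    (hba : ∀ k (E : LatticeShear.LagrangianLatticeCarrier k), E.LPermissible → E.Regular →
    ∀ (m : ℕ) (𝔸 : Torus.Visc4 (Fin 3)) (lo hi : ℝ), 0 < lo → Torus.NearIso 𝔸 lo hi →
      ∀ (w₀ : VF) (u : ℝ → VF), IsDatum w₀ → TSol E m 𝔸 w₀ u →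
        ∀ᵐ t ∂(volume.restrict (Ioo (1/2 : ℝ) 1)),
          (1 - Real.exp (-(4 * Real.pi ^ 2 * lo))) * Torus.vectorL2Sq w₀ ≤ drop w₀ u t)
    (hone : ∀ k (W : Literature.Analysis.FluidPDE.LatticeShear.LatticeWord k) (M : ℝ) (hM : 0 < M) (c : ℝ), 0 < c →
    ∀ (Φ : ℝ → Torus.Visc4 (Fin 3) → Torus.Visc4 (Fin 3)) (lo hi Λ β σ C ν₀ K Cf νf Kf : ℝ),
      0 < lo → lo ≤ 1 → 1 ≤ hi → 1 < Λ → 0 ≤ β →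
      0 < σ → 0 ≤ C → 0 < ν₀ → 0 < K → SlowVectorClauseF W M hM c Φ lo hi Λ β σ C ν₀ K →
      0 ≤ Cf → 0 < νf → 0 < Kf → CellEnergyClauses W M hM c lo hi Λ β Cf νf Kf →
      ∃ ν₁ > (0:ℝ), ∃ K₁ > (0:ℝ), ∃ Λ₀ : ℕ, ∃ θ₀ > (0:ℝ), ∃ C₁ > (0:ℝ), ∃ σ₁ > (0:ℝ),
        ∀ E : Literature.Analysis.FluidPDE.LatticeShear.LagrangianLatticeCarrier k, E.design = W.stretch M hM → E.gain = c → E.nu0 = ν₁ → E.K = K₁ → E.LPermissible → E.Regular → (∀ m, Λ₀ * E.N m ≤ E.N (m + 1)) → (∀ m, E.N m ^ 2 ≤ E.N (m + 1)) → (∀ m, E.cellVisc (m + 1) * ((E.N (m + 1) : ℝ) / E.N m) ^ (1 / 4 : ℝ) ≤ 1) → (∀ m, E.K * ((E.N (m + 1) : ℝ) / E.N m) ^ (1 / 4 : ℝ) ≤ ((E.N (m + 1) : ℝ) / E.N m) * E.cellVisc (m + 1)) → (∀ m, E.θ (m + 1) * ((E.N (m + 1) : ℝ) / E.N m) ^ (1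 / 16 : ℝ) ≤ θ₀) → (∀ m, ((E.N (m + 1) : ℝ) / E.N m) ^ (1 / 16 : ℝ) * E.physPeriod (m + 1) ≤ E.refresh (m + 1)) →
        ∀ R : ℝ≥0, ∃ mstar : ℕ, ∀ m, mstar ≤ m →
          ∀ S : Torus.Visc4 (Fin 3), Torus.OddSmall S β → Torus.NearIso S lo hi →
            Torus.OddSmall (Φ (E.cellVisc (m + 1)) S) β → Torus.NearIso (Φ (E.cellVisc (m + 1)) S) lo hi →
          ∀ (w₀ : VF), IsDatum w₀ → InClass R w₀ →
          ∀ u v : ℝ → VF, TSol E (m + 1) (E.kbar (m + 1) • S) w₀ u →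
            TSol E m (E.kbar m • renormStep (Φ (E.cellVisc (m + 1))) (E.gain / E.cellVisc (m + 1) ^ 2) S) w₀ v →
            ∀ᵐ t ∂(volume.restrict (Ioo (1/2 : ℝ) 1)),
              (1 - C₁ * ((E.N m : ℝ) / E.N (m + 1)) ^ σ₁) * drop w₀ v t ≤ drop w₀ u t) :
    ∀ k (W : Literature.Analysis.FluidPDE.LatticeShear.LatticeWord k) (M : ℝ) (hM : 0 < M) (c : ℝ), 0 < c →
    ∀ (Φ : ℝ → Torus.Visc4 (Fin 3) → Torus.Visc4 (Fin 3)) (lo hi Λ β τlo τhi τc σ C ν₀ K Cf νf Kf : ℝ),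
      0 < lo → lo ≤ 1 → 1 ≤ hi → 1 < Λ → 0 ≤ β → (∀ ν, SectorialWindowClause (Φ ν) lo hi Λ τlo τhi) →
      τc ∈ Set.Icc τlo τhi → 0 ≤ τc → τc * hi ≤ β →
      0 < σ → 0 ≤ C → 0 < ν₀ → 0 < K → SlowVectorClauseF W M hM c Φ lo hi Λ β σ C ν₀ K →
      0 ≤ Cf → 0 < νf → 0 < Kf → CellEnergyClauses W M hM c lo hi Λ β Cf νf Kf →
      ∃ ν₁ > (0:ℝ), ∃ K₁ > (0:ℝ), ∃ Λ₀ : ℕ, ∃ θ₀ > (0:ℝ),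
        ∀ E : Literature.Analysis.FluidPDE.LatticeShear.LagrangianLatticeCarrier k, E.design = W.stretch M hM → E.gain = c → E.nu0 = ν₁ → E.K = K₁ → E.LPermissible → E.Regular → (∀ m, Λ₀ * E.N m ≤ E.N (m + 1)) → (∀ m, E.N m ^ 2 ≤ E.N (m + 1)) → (∀ m, E.cellVisc (m + 1) * ((E.N (m + 1) : ℝ) / E.N m) ^ (1 / 4 : ℝ) ≤ 1) → (∀ m, E.K * ((E.N (m + 1) : ℝ) / E.N m) ^ (1 / 4 : ℝ) ≤ ((E.N (m + 1) : ℝ) / E.N m) * E.cellVisc (m + 1)) → (∀ m, E.θ (m + 1) * ((E.N (m + 1) : ℝ) / E.N m) ^ (1 / 16 : ℝ) ≤ θ₀) → (∀ m, ((E.N (m + 1) : ℝ) / E.N m) ^ (1 / 16 : ℝ) * E.physPeriod (m + 1) ≤ E.refresh (m + 1)) → ChainLower E := by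
  intro k W M hM c hc Φ lo hi Λ β τlo τhi τc σ C ν₀ K Cf νf Kf hlo hlo1 hhi1 hΛ hβ hwin hτc hτc0 hτcβ hσ hC hν₀ hK hV hCf hνf hKf hEcl
  obtain ⟨ν₁, hν₁, K₁, hK₁, Λ₀, θ₀, hθ₀, C₁, hC₁, σ₁, hσ₁, hlev⟩ :=
    hone k W M hM c hc Φ lo hi Λ β σ C ν₀ K Cf νf Kf hlo hlo1 hhi1 hΛ hβ hσ hC hν₀ hK hV hCf hνf hKf hEcl
  refine ⟨ν₁, hν₁, K₁, hK₁, Λ₀, θ₀, hθ₀, ?_⟩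
  intro E hW hg hn hK' hP hR h1a h1b h2 h3 h4 h5
  have hlevE := hlev E hW hg hn hK' hP hR h1a h1b h2 h3 h4 h5
  have hhi0 : 0 ≤ hi := zero_le_one.trans hhi1
  have hτhi : 0 ≤ τc * hi := mul_nonneg hτc0 hhi0
  have hfacts := fun j m => chainTensorF_sectorial E hlo.le hlo1 hhi1 hΛ.le hτc hτc0 hwin j m
  have hwinT : ∀ j m, Torus.NearIso (chainTensorF E Φ j m) (E.kbar m * lo) (E.kbar m * hi) := fun j m => (hfacts j m).2.2
  refine ⟨lo, hlo, hi, C₁, hC₁, σ₁, hσ₁, ?_⟩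
  intro R
  obtain ⟨mstar, hm⟩ := hlevE R
  refine ⟨mstar, fun j hj => ⟨chainTensorF E Φ j, chainTensorF_top E Φ j, fun m _ _ => hwinT j m, ?_⟩⟩
  intro m hm1 hm2 w₀ hdat hcl
  obtain ⟨_, ⟨hΦo, hΦn⟩, _⟩ := hfacts j m
  obtain ⟨⟨hSo, hSn⟩, _, _⟩ := hfacts j (m + 1)
  have hstep := hm m hm1 _ (hSo.mono hτhi hτcβ) hSn (hΦo.mono hτhi hτcβ) hΦn w₀ hdat hcl
  refine ⟨existsL_tensor E hR m (hwinT j m) (mul_pos (E.kbar_pos m) hlo) w₀ hdat, ?_⟩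
  intro u v hu hv
  have hv' := hv
  rw [chainTensorF_succ E Φ hm2] at hv'
  have hu' : TSol E (m + 1) (E.kbar (m + 1) • shapeSeqF (fun i => Φ (E.cellVisc i)) (fun i => E.gain / E.cellVisc i ^ 2) j (j - (m + 1))) w₀ u := hu
  have hcmp := hstep u v hu' hv'
  have hbase := hba k E hP hR m (chainTensorF E Φ j m) (E.kbar m * lo) (E.kbar m * hi)
    (mul_pos (E.kbar_pos m) hlo) (hwinT j m) w₀ v hdat hv
  have hcb : 0 ≤ 1 - Real.exp (-(4 * Real.pi ^ 2 * (E.kbar m * lo))) := by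
    have hexp : Real.exp (-(4 * Real.pi ^ 2 * (E.kbar m * lo))) < 1 := by
      rw [Real.exp_lt_one_iff]
      have : 0 < 4 * Real.pi ^ 2 * (E.kbar m * lo) := by
        have := E.kbar_pos m
        positivity
      linarith
    linarith
  have hL2 : 0 ≤ Torus.vectorL2Sq w₀ := by
    show 0 ≤ ∫ x, ‖w₀ x‖ ^ 2
    exact integral_nonneg fun x => by positivity
  filter_upwards [hcmp, hbase] with t h1 h2
  exact ⟨le_trans (mul_nonneg hcb hL2) h2, h1⟩

/-! ## §7 AMENDMENT 2 — SECTORIAL guard × DEFECT family: the v2 window typing of record (tenure D24-3, STATUS 12:48:03Z)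

D24-3: «v2 window typing of record = p4 defect family + SECTORIAL odd guard + p5 W5 `OddChannelBound` + `stub_oneLevelL_I`».  §6 proved the
consumer facts for the I-centred sectorial clause (`SectorialWindowClause`) only and merely TYPED the S⋆-centred one.  This section proves them
for `SectorialIntervalWindowClause` (S⋆ centre, defect `μ`, sector `τ ∈ [τlo, τhi]`): chain induction `shapeSeqF_intervalS` / `shapeSeqF_imageS`,
CONSUMER FACT 1 `chainTensorF_nearIsoS` / `chainImage_nearIsoS` (outputs ABSOLUTE `OddSmall (τc·hi) ∧ NearIso lo hi`, exactly what the
window-agnostic `stub_oneLevelL_I` eats), CONSUMER FACT 2 `nearIso_effTensorIS` / `exists_effective_singleModeIS` / the family adapter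
`slowVectorClauseF_of_noExF_intervalS` ((V)'s absolute `OddSmall 𝔸 (ν·β)` converted to the sector `β·ΛV/lo`), the package
`SectorialIntervalWindowFamily` (= `IntervalWindowFamily`'s eleven conjuncts + four sector bookkeeping facts), the candidate stub text
`stub_cellLawW_IS`, the PROVED glue `chainLower_of_pieces_IS`, the `μ ≡ 1` discharge `tailDefectBound_one` (p5 (3): the I-centred
instantiation is admissible at a = 2 under the sectorial guard — a prover instantiating `μ := fun _ => 1` owes nothing for `TailDefectBound`),
and the SECTORIAL form `SectorialOddChannelBound` of p5's W5 gain-plus-source interface with `sectorialIntervalWindowClause_of_channelBound`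
(odd half of the clause from `κ·τ + ε ≤ τ` on `[τlo, τhi]`, i.e. `τlo ≥ ε/(1-κ)`; p5: `β ≥ ε/(1-κ)`).
NUMBERS OF RECORD (F-p4g9-2; kit j308857 = hill-climb lower bounds on the sup, p5 j308758 = LP-exact): sectorial odd gain of `DΦ_{W₀}` at the
fixed point 0.5008/0.5066 (two seeds) vs LP-exact 0.510 — scale-free along the isotropic ray to 4 digits; over 48 anisotropic even windows of
aspect 1.3–57: 0.45–0.62 (p5: 0.52–0.58 at aspect ≤ 3), NO growth with aspect; frozen map and rate-dependent map at M = 30 / 300 agree to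
4 digits (saturation correction ≈ 24/(T b)² ≈ 1e-9).  Structural ceiling 1 for the frozen map (every word: `sector_inv` + congruence + sums). -/

/-- With no centre defect the running aspect is constant. -/
theorem aspF_one (lam₀ : ℝ) (j : ℕ) : ∀ d, aspF (fun _ => (1:ℝ)) lam₀ j d = lam₀
  | 0 => rfl
  | d + 1 => by rw [aspF, aspF_one lam₀ j d, one_mul]

/-- The `μ ≡ 1` (I-centred / exact-interval) instantiation owes NOTHING for the tail bound: `TailDefectBound 1 λ₀ Λc` iff-trivially from `λ₀ ≤ Λc`. -/
theorem tailDefectBound_one {lam₀ Λc : ℝ} (h : lam₀ ≤ Λc) : TailDefectBound (fun _ => 1) lam₀ Λc :=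
  fun _ _ _ _ _ => ⟨0, fun j d _ => (aspF_one lam₀ j d).le.trans h⟩

/-- INDUCTION ALONG THE FAMILY CHAIN, sectorial × defect.  Under `∀ i, SectorialIntervalWindowClause (Ψ i) S⋆ slo shi λ₀ Λ τlo τhi (μ i)`,
for every `τ ∈ [τlo, τhi]`, every shape of depth `d` with running aspect `aspF μ λ₀ j d ≤ Λ` is in the sector `τ` and in `[[S⋆/aspF d, aspF d·S⋆]]`. -/
theorem shapeSeqF_intervalS {Ψ : ℕ → T4 → T4} {Sstar : T4} {slo shi lam₀ Λ τlo τhi τ : ℝ} {μ : ℕ → ℝ}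
    (hslo : 0 ≤ slo) (hτ : τ ∈ Set.Icc τlo τhi)
    (hwin : ∀ i, SectorialIntervalWindowClause (Ψ i) Sstar slo shi lam₀ Λ τlo τhi (μ i))
    (hμ : ∀ i, 1 ≤ μ i) {g : ℕ → ℝ} (hg : ∀ i, 0 ≤ g i) (j : ℕ) :
    ∀ d, aspF μ lam₀ j d ≤ Λ →
      OddSectorial (shapeSeqF Ψ g j d) τ ∧ InInterval Sstar (aspF μ lam₀ j d) (shapeSeqF Ψ g j d)
  | 0, _ => ⟨oddSectorial_isoVisc 1 τ, (hwin 0).2.2.1⟩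
  | d + 1, hΛ => by
      have hlam₀ : 1 ≤ lam₀ := (hwin 0).2.1
      have h0 : (0:ℝ) ≤ lam₀ := zero_le_one.trans hlam₀
      have hle : aspF μ lam₀ j d ≤ aspF μ lam₀ j (d + 1) := aspF_le_succ hμ h0 j d
      obtain ⟨ho, hi'⟩ := shapeSeqF_intervalS hslo hτ hwin hμ hg j d (hle.trans hΛ)
      have hpos : TransNonneg Sstar := transNonneg_of_nearIso (hwin 0).1 hslo
      have hlam : aspF μ lam₀ j d ∈ Set.Icc lam₀ Λ := ⟨lam₀_le_aspF hμ h0 j d, hle.trans hΛ⟩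
      have hlam1 : 1 ≤ aspF μ lam₀ j d := hlam₀.trans hlam.1
      have hlampos : 0 < aspF μ lam₀ j d := lt_of_lt_of_le one_pos hlam1
      obtain ⟨hΦo, hΦi⟩ := (hwin (j - d)).2.2.2 τ hτ _ hlam _ ho hi'
      have hμlam1 : 1 ≤ μ (j - d) * aspF μ lam₀ j d := one_le_mul_of_one_le_of_one_le (hμ _) hlam1
      have hSnn : TransNonneg (shapeSeqF Ψ g j d) :=
        transNonneg_of_nearIso (InInterval.nearIso hlam1 (hwin 0).1 hi') (div_nonneg hslo hlampos.le)
      have hΦnn : TransNonneg (Ψ (j - d) (shapeSeqF Ψ g j d)) :=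
        transNonneg_of_nearIso (InInterval.nearIso hμlam1 (hwin 0).1 hΦi) (div_nonneg hslo (zero_le_one.trans hμlam1))
      exact ⟨oddSectorial_renormStep (hg _) hSnn hΦnn ho hΦo, renormStep_interval (hg _) (hi'.mono hpos hlampos hle) hΦi⟩

/-- … and one more clause application: the `Ψ (j-d)`-IMAGE of the depth-`d` shape. -/
theorem shapeSeqF_imageS {Ψ : ℕ → T4 → T4} {Sstar : T4} {slo shi lam₀ Λ τlo τhi τ : ℝ} {μ : ℕ → ℝ}
    (hslo : 0 ≤ slo) (hτ : τ ∈ Set.Icc τlo τhi)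
    (hwin : ∀ i, SectorialIntervalWindowClause (Ψ i) Sstar slo shi lam₀ Λ τlo τhi (μ i))
    (hμ : ∀ i, 1 ≤ μ i) {g : ℕ → ℝ} (hg : ∀ i, 0 ≤ g i) (j d : ℕ) (hΛ : aspF μ lam₀ j (d + 1) ≤ Λ) :
    OddSectorial (Ψ (j - d) (shapeSeqF Ψ g j d)) τ ∧ InInterval Sstar (aspF μ lam₀ j (d + 1)) (Ψ (j - d) (shapeSeqF Ψ g j d)) := by
  have h0 : (0:ℝ) ≤ lam₀ := zero_le_one.trans (hwin 0).2.1
  have hle : aspF μ lam₀ j d ≤ aspF μ lam₀ j (d + 1) := aspF_le_succ hμ h0 j d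
  obtain ⟨ho, hi'⟩ := shapeSeqF_intervalS hslo hτ hwin hμ hg j d (hle.trans hΛ)
  exact (hwin (j - d)).2.2.2 τ hτ _ ⟨lam₀_le_aspF hμ h0 j d, hle.trans hΛ⟩ _ ho hi'

/-- **CONSUMER FACT 1 (chain), sectorial × defect.**  Under the family clause, defects `μ ≥ 1`, the tail bound from level `m₁` on and a chain
sector `τc ∈ [τlo, τhi]`, `τc ≥ 0`: for `m₁ ≤ m ≤ j` the level-`m` shape is `OddSmall (τc·hi) ∧ NearIso lo hi` (ABSOLUTE, as `stub_oneLevelL_I`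
wants it) and the level-`m` TENSOR is `NearIso (kbar m·lo) (kbar m·hi)`. -/
theorem chainTensorF_nearIsoS {k : ℕ} (E : LatticeShear.LagrangianLatticeCarrier k)
    {Φ : ℝ → T4 → T4} {Sstar : T4} {slo shi lam₀ Λ τlo τhi τc : ℝ} {μ : ℝ → ℝ} {Λc lo hi : ℝ}
    (hslo : 0 ≤ slo) (hτ : τc ∈ Set.Icc τlo τhi) (hτ0 : 0 ≤ τc)
    (hwin : ∀ ν, SectorialIntervalWindowClause (Φ ν) Sstar slo shi lam₀ Λ τlo τhi (μ ν)) (hμ : ∀ ν, 1 ≤ μ ν)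
    (hΛc : Λc ≤ Λ) (hlo : 0 ≤ lo) (hloc : lo * Λc ≤ slo) (hhic : shi * Λc ≤ hi)
    {m₁ : ℕ} (htail : ∀ j d : ℕ, m₁ + d ≤ j → aspF (fun i => μ (E.cellVisc i)) lam₀ j d ≤ Λc)
    {j m : ℕ} (hm : m₁ ≤ m) (hmj : m ≤ j) :
    (Torus.OddSmall (shapeSeqF (fun i => Φ (E.cellVisc i)) (fun i => E.gain / E.cellVisc i ^ 2) j (j - m)) (τc * hi) ∧
      Torus.NearIso (shapeSeqF (fun i => Φ (E.cellVisc i)) (fun i => E.gain / E.cellVisc i ^ 2) j (j - m)) lo hi) ∧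
    Torus.NearIso (chainTensorF E Φ j m) (E.kbar m * lo) (E.kbar m * hi) := by
  have hwin' : ∀ i, SectorialIntervalWindowClause (Φ (E.cellVisc i)) Sstar slo shi lam₀ Λ τlo τhi (μ (E.cellVisc i)) := fun i => hwin _
  have hμ' : ∀ i, 1 ≤ (fun i => μ (E.cellVisc i)) i := fun i => hμ _
  have hgpos : ∀ i, 0 ≤ E.gain / E.cellVisc i ^ 2 := fun i => div_nonneg E.gain_pos.le (sq_nonneg _)
  have h0 : (0:ℝ) ≤ lam₀ := zero_le_one.trans (hwin 0).2.1
  have hd : m₁ + (j - m) ≤ j := by omega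
  have hasp : aspF (fun i => μ (E.cellVisc i)) lam₀ j (j - m) ≤ Λc := htail j (j - m) hd
  obtain ⟨ho, hi'⟩ := shapeSeqF_intervalS hslo hτ hwin' hμ' hgpos j (j - m) (hasp.trans hΛc)
  have h1 : 1 ≤ aspF (fun i => μ (E.cellVisc i)) lam₀ j (j - m) := le_trans (hwin 0).2.1 (lam₀_le_aspF hμ' h0 j (j - m))
  have hS : Torus.NearIso (shapeSeqF (fun i => Φ (E.cellVisc i)) (fun i => E.gain / E.cellVisc i ^ 2) j (j - m)) lo hi :=
    nearIso_of_inInterval_le (hwin 0).1 hslo h1 hasp hlo hloc hhic hi'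
  exact ⟨⟨ho.oddSmall hS hlo hτ0, hS⟩, hS.smul (E.kbar_pos m).le⟩

/-- The IMAGE facts fed to `stub_oneLevelL_I` at level `m` (`m₁ ≤ m < j`), sectorial × defect. -/
theorem chainImage_nearIsoS {k : ℕ} (E : LatticeShear.LagrangianLatticeCarrier k)
    {Φ : ℝ → T4 → T4} {Sstar : T4} {slo shi lam₀ Λ τlo τhi τc : ℝ} {μ : ℝ → ℝ} {Λc lo hi : ℝ}
    (hslo : 0 ≤ slo) (hτ : τc ∈ Set.Icc τlo τhi) (hτ0 : 0 ≤ τc)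
    (hwin : ∀ ν, SectorialIntervalWindowClause (Φ ν) Sstar slo shi lam₀ Λ τlo τhi (μ ν)) (hμ : ∀ ν, 1 ≤ μ ν)
    (hΛc : Λc ≤ Λ) (hlo : 0 ≤ lo) (hloc : lo * Λc ≤ slo) (hhic : shi * Λc ≤ hi)
    {m₁ : ℕ} (htail : ∀ j d : ℕ, m₁ + d ≤ j → aspF (fun i => μ (E.cellVisc i)) lam₀ j d ≤ Λc)
    {j m : ℕ} (hm : m₁ ≤ m) (hmj : m < j) :
    Torus.OddSmall (Φ (E.cellVisc (m + 1)) (shapeSeqF (fun i => Φ (E.cellVisc i)) (fun i => E.gain / E.cellVisc i ^ 2) j (j - (m + 1)))) (τc * hi) ∧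
    Torus.NearIso (Φ (E.cellVisc (m + 1)) (shapeSeqF (fun i => Φ (E.cellVisc i)) (fun i => E.gain / E.cellVisc i ^ 2) j (j - (m + 1)))) lo hi := by
  have hwin' : ∀ i, SectorialIntervalWindowClause (Φ (E.cellVisc i)) Sstar slo shi lam₀ Λ τlo τhi (μ (E.cellVisc i)) := fun i => hwin _
  have hμ' : ∀ i, 1 ≤ (fun i => μ (E.cellVisc i)) i := fun i => hμ _
  have hgpos : ∀ i, 0 ≤ E.gain / E.cellVisc i ^ 2 := fun i => div_nonneg E.gain_pos.le (sq_nonneg _)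
  have h0 : (0:ℝ) ≤ lam₀ := zero_le_one.trans (hwin 0).2.1
  set d : ℕ := j - (m + 1) with hd_def
  have hjd : j - d = m + 1 := by omega
  have hd1 : m₁ + (d + 1) ≤ j := by omega
  have hasp : aspF (fun i => μ (E.cellVisc i)) lam₀ j (d + 1) ≤ Λc := htail j (d + 1) hd1
  obtain ⟨ho, hi'⟩ := shapeSeqF_imageS hslo hτ hwin' hμ' hgpos j d (hasp.trans hΛc)
  rw [hjd] at ho hi'
  have h1 : 1 ≤ aspF (fun i => μ (E.cellVisc i)) lam₀ j (d + 1) := le_trans (hwin 0).2.1 (lam₀_le_aspF hμ' h0 j (d + 1))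
  have hN : Torus.NearIso (Φ (E.cellVisc (m + 1)) (shapeSeqF (fun i => Φ (E.cellVisc i)) (fun i => E.gain / E.cellVisc i ^ 2) j d)) lo hi :=
    nearIso_of_inInterval_le (hwin 0).1 hslo h1 hasp hlo hloc hhic hi'
  exact ⟨ho.oddSmall hN hlo hτ0, hN⟩

/-- **CONSUMER FACT 2 (F2), sectorial × defect: ellipticity of the effective tensor.**  For `(1/ν)•𝔸` in the sector `τ ∈ [τlo, τhi]` and in the
interval of aspect `λ ∈ [λ₀, Λ]`, the effective cell tensor is `NearIso` with lower constant `(1/n²)(ν + c/ν)·slo/(μλ) > 0`. -/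
theorem nearIso_effTensorIS {Φν : T4 → T4} {Sstar : T4} {slo shi lam₀ Λ τlo τhi μ τ : ℝ}
    (hwin : SectorialIntervalWindowClause Φν Sstar slo shi lam₀ Λ τlo τhi μ) (hμ : 1 ≤ μ) (hslo : 0 ≤ slo)
    (hτ : τ ∈ Set.Icc τlo τhi) {ν c : ℝ} (hν : 0 < ν) (hc : 0 ≤ c) {n : ℕ} {𝔸 : T4}
    (hsec : OddSectorial ((1 / ν) • 𝔸) τ)
    {lam : ℝ} (hlam : lam ∈ Set.Icc lam₀ Λ) (hA : InInterval Sstar lam ((1 / ν) • 𝔸)) :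
    Torus.NearIso ((1 / (n:ℝ) ^ 2) • (𝔸 + (c / ν) • Φν ((1 / ν) • 𝔸)))
      ((1 / (n:ℝ) ^ 2) * ((ν + c / ν) * (slo / (μ * lam)))) ((1 / (n:ℝ) ^ 2) * ((ν + c / ν) * (shi * (μ * lam)))) := by
  obtain ⟨hstar, hlam₀, _, hstep⟩ := hwin
  have hlam1 : 1 ≤ lam := le_trans hlam₀ hlam.1
  have hlampos : 0 < lam := lt_of_lt_of_le one_pos hlam1
  have hμlam : 1 ≤ μ * lam := one_le_mul_of_one_le_of_one_le hμ hlam1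
  have hle : lam ≤ μ * lam := le_mul_of_one_le_left hlampos.le hμ
  obtain ⟨_, hΦi⟩ := hstep τ hτ lam hlam _ hsec hA
  have hpos : TransNonneg Sstar := transNonneg_of_nearIso hstar hslo
  have hX : Torus.NearIso ((1 / ν) • 𝔸) (slo / (μ * lam)) (shi * (μ * lam)) :=
    InInterval.nearIso hμlam hstar (hA.mono hpos hlampos hle)
  have hΦ : Torus.NearIso (Φν ((1 / ν) • 𝔸)) (slo / (μ * lam)) (shi * (μ * lam)) := InInterval.nearIso hμlam hstar hΦi
  have hA𝔸 : Torus.NearIso 𝔸 (ν * (slo / (μ * lam))) (ν * (shi * (μ * lam))) := by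
    have h := hX.smul (c := ν) hν.le
    rwa [smul_smul, mul_one_div_cancel hν.ne', one_smul] at h
  have hcν : 0 ≤ c / ν := div_nonneg hc hν.le
  have hsum := hA𝔸.add (hΦ.smul hcν)
  have hn : (0:ℝ) ≤ 1 / (n:ℝ) ^ 2 := by positivity
  have h := hsum.smul hn
  exact nearIso_congr h (by ring) (by ring)

/-- **Existence of the effective single-mode solution, sectorial × defect** (Lions): (V)'s ABSOLUTE odd hypothesis `OddSmall 𝔸 (ν·β)` and its band
`NearIso 𝔸 (ν·lo/λ) (ν·hi·λ)`, `λ ≤ ΛV`, are converted to the sector `β·ΛV/lo` (which must lie in `[τlo, τhi]`) and to the interval of aspect `Λ'`.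
[cite: LionsMagenes1972, Chap. 3 Thm. 1.1] -/
theorem exists_effective_singleModeIS {Φν : T4 → T4} {Sstar : T4} {slo shi lam₀ Λ τlo τhi β μ : ℝ}
    (hwin : SectorialIntervalWindowClause Φν Sstar slo shi lam₀ Λ τlo τhi μ) (hμ : 1 ≤ μ) (hslo : 0 < slo)
    {lo hi ΛV Λ' : ℝ} (hlo : 0 < lo) (hhi : 0 ≤ hi) (hΛ' : Λ' ∈ Set.Icc lam₀ Λ)
    (hc1 : ΛV * shi ≤ Λ' * lo) (hc2 : ΛV * hi ≤ Λ' * slo) (hβ : 0 ≤ β) (hτF : β * ΛV / lo ∈ Set.Icc τlo τhi)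
    {ν c K : ℝ} (hν : 0 < ν) (hc : 0 ≤ c) (hK : 0 < K) {n : ℕ}
    {𝔸 : T4} (hodd : Torus.OddSmall 𝔸 (ν * β))
    (hwin' : ∃ lam ∈ Set.Icc (1:ℝ) ΛV, Torus.NearIso 𝔸 (ν * (lo / lam)) (ν * (hi * lam)))
    {ℓ : Fin 3 → ℤ} (hℓ : ℓ ≠ 0) (hsep : ‖Torus.latticeVec ℓ‖ * (⌈K / ν⌉₊ : ℝ) ≤ n)
    {p : EuclideanSpace ℝ (Fin 3)} (hperp : ⟪p, Torus.latticeVec ℓ⟫_ℝ = 0) {T : ℝ} (hT : 0 < T) :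
    ∃ v : ℝ → VF, Torus.IsWeakTensorPassiveVectorOn 0 (2 * T) ((1 / (n:ℝ) ^ 2) • (𝔸 + (c / ν) • Φν ((1 / ν) • 𝔸))) (fun _ _ => 0)
      (fun x => (UnitAddTorus.mFourier ℓ x).re • p) v := by
  obtain ⟨lam, hlam, hA⟩ := hwin'
  have hlam0 : 0 < lam := lt_of_lt_of_le one_pos hlam.1
  have hΛ'1 : 1 ≤ Λ' := le_trans hwin.2.1 hΛ'.1
  have hΛ'pos : 0 < Λ' := lt_of_lt_of_le one_pos hΛ'1
  have hshi : 0 < shi := by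
    -- `slo ≤ shi` at the transverse pair `k = e₀`, `p = e₁`
    set k : Fin 3 → ℝ := fun i => if i = 0 then 1 else 0 with hk
    set q : Fin 3 → ℝ := fun i => if i = 1 then 1 else 0 with hq
    have hkq : ∑ i, q i * k i = 0 := by simp [hk, hq]
    have hQ : (∑ a, k a ^ 2) * (∑ i, q i ^ 2) = 1 := by simp [hk, hq]
    obtain ⟨hl, hh⟩ := hwin.1 k q hkq
    rw [hQ] at hl hh
    linarith
  have hX : Torus.NearIso ((1 / ν) • 𝔸) (lo / lam) (hi * lam) := by
    have h := hA.smul (c := 1 / ν) (by positivity)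
    exact nearIso_congr h (by field_simp) (by field_simp)
  have hsec : OddSectorial ((1 / ν) • 𝔸) (β * ΛV / lo) := by
    have hodd' : Torus.OddSmall ((1 / ν) • 𝔸) β := by
      have h := hodd.smul (1 / ν)
      exact oddSmall_congr h (by field_simp)
    have h0 := oddSectorial_of_oddSmall hodd' hX (div_pos hlo hlam0)
    refine h0.mono (transNonneg_of_nearIso hX (div_nonneg hlo.le hlam0.le)) (div_nonneg hβ (div_nonneg hlo.le hlam0.le)) ?_
    rw [div_div_eq_mul_div, div_le_div_iff_of_pos_right hlo]
    exact mul_le_mul_of_nonneg_left hlam.2 hβ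
  have h1 : shi ≤ Λ' * (lo / lam) := by
    rw [mul_div_assoc', le_div_iff₀ hlam0]
    calc shi * lam ≤ shi * ΛV := mul_le_mul_of_nonneg_left hlam.2 hshi.le
      _ = ΛV * shi := mul_comm _ _
      _ ≤ Λ' * lo := hc1
  have h2 : hi * lam ≤ Λ' * slo := by
    calc hi * lam ≤ hi * ΛV := mul_le_mul_of_nonneg_left hlam.2 hhi
      _ = ΛV * hi := mul_comm _ _
      _ ≤ Λ' * slo := hc2
  have hI : InInterval Sstar Λ' ((1 / ν) • 𝔸) := inInterval_of_nearIso hwin.1 hX hΛ'pos h1 h2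
  have hN := nearIso_effTensorIS (n := n) (c := c) hwin hμ hslo.le hτF hν hc hsec hΛ' hI
  have hn1 : 1 ≤ (n:ℝ) := one_le_of_slowBand hℓ hK hν hsep
  have hlo' : 0 < (1 / (n:ℝ) ^ 2) * ((ν + c / ν) * (slo / (μ * Λ'))) := by
    have : 0 < ν + c / ν := by positivity
    have : 0 < μ * Λ' := mul_pos (lt_of_lt_of_le one_pos hμ) hΛ'pos
    positivity
  exact FluidPDE.Torus.exists_isWeakTensorPassiveVectorOn_zero_carrier (by linarith) hN hlo'
    (memLp_two_of_memSobolev_one_complexify (memSobolev_one_singleMode ℓ p))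
    (isWeaklyDivFree_singleMode ℓ hperp)

/-- **THE FAMILY ADAPTER (V_ν without existence ⇒ V_ν), sectorial × defect** — (V)'s text byte-identical. -/
theorem slowVectorClauseF_of_noExF_intervalS {k : ℕ} {W : LatticeShear.LatticeWord k} {M : ℝ} {hM : 0 < M} {c : ℝ}
    {Φ : ℝ → T4 → T4} {Sstar : T4} {slo shi lam₀ Λ τlo τhi β : ℝ} {μ : ℝ → ℝ} {lo hi ΛV Λ' σ C ν₀ K : ℝ}
    (hc : 0 < c) (hwin : ∀ ν, SectorialIntervalWindowClause (Φ ν) Sstar slo shi lam₀ Λ τlo τhi (μ ν)) (hμ : ∀ ν, 1 ≤ μ ν) (hslo : 0 < slo)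
    (hlo : 0 < lo) (hhi : 0 ≤ hi) (hK : 0 < K) (hΛ' : Λ' ∈ Set.Icc lam₀ Λ) (hc1 : ΛV * shi ≤ Λ' * lo) (hc2 : ΛV * hi ≤ Λ' * slo)
    (hβ : 0 ≤ β) (hτF : β * ΛV / lo ∈ Set.Icc τlo τhi)
    (h : SlowVectorClauseNoExF W M hM c Φ lo hi ΛV β σ C ν₀ K) : SlowVectorClauseF W M hM c Φ lo hi ΛV β σ C ν₀ K := by
  intro ν hν n 𝔸 hodd hwin' ℓ hℓ hsep p hp hperp T hT
  exact ⟨exists_effective_singleModeIS (hwin ν) (hμ ν) hslo hlo hhi hΛ' hc1 hc2 hβ hτF hν.1 hc.le hK hodd hwin' hℓ hsep hperp hT,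
    h ν hν n 𝔸 hodd hwin' ℓ hℓ hsep p hp hperp T hT⟩

/-- **THE SECTORIAL INTERVAL WINDOW PACKAGE for the family** — `IntervalWindowFamily`'s eleven conjuncts with the sectorial clause, plus the four
sector bookkeeping facts: chain sector `τc ∈ [τlo, τhi]`, `τc ≥ 0`, `τc·hi ≤ β` (feeds the absolute `OddSmall S β` of `stub_oneLevelL_I` / (T) / (L)),
and the F2 sector `β·ΛV/lo ∈ [τlo, τhi]`. -/
def SectorialIntervalWindowFamily (Φ : ℝ → T4 → T4) (μ : ℝ → ℝ) (Sstar : T4)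
    (slo shi lam₀ Λ Λc Λ' τlo τhi τc β lo hi ΛV : ℝ) : Prop :=
  (∀ ν, SectorialIntervalWindowClause (Φ ν) Sstar slo shi lam₀ Λ τlo τhi (μ ν)) ∧ (∀ ν, 1 ≤ μ ν) ∧ TailDefectBound μ lam₀ Λc ∧
  0 < slo ∧ lam₀ ≤ Λc ∧ Λc ≤ Λ ∧ lo * Λc ≤ slo ∧ shi * Λc ≤ hi ∧
  Λ' ∈ Set.Icc lam₀ Λ ∧ ΛV * shi ≤ Λ' * lo ∧ ΛV * hi ≤ Λ' * slo ∧
  τc ∈ Set.Icc τlo τhi ∧ 0 ≤ τc ∧ τc * hi ≤ β ∧ β * ΛV / lo ∈ Set.Icc τlo τhi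

/-- The adapter through the package. -/
theorem slowVectorClauseF_of_noExF_familyS {k : ℕ} {W : LatticeShear.LatticeWord k} {M : ℝ} {hM : 0 < M} {c : ℝ}
    {Φ : ℝ → T4 → T4} {μ : ℝ → ℝ} {Sstar : T4} {slo shi lam₀ Λ Λc Λ' τlo τhi τc β lo hi ΛV σ C ν₀ K : ℝ}
    (hc : 0 < c) (hlo : 0 < lo) (hhi : 0 ≤ hi) (hK : 0 < K) (hβ : 0 ≤ β)
    (hWF : SectorialIntervalWindowFamily Φ μ Sstar slo shi lam₀ Λ Λc Λ' τlo τhi τc β lo hi ΛV)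
    (h : SlowVectorClauseNoExF W M hM c Φ lo hi ΛV β σ C ν₀ K) : SlowVectorClauseF W M hM c Φ lo hi ΛV β σ C ν₀ K := by
  obtain ⟨hwin, hμ, _, hslo, _, _, _, _, hΛ', hc1, hc2, _, _, _, hτF⟩ := hWF
  exact slowVectorClauseF_of_noExF_intervalS hc hwin hμ hslo hlo hhi hK hΛ' hc1 hc2 hβ hτF h

/-- CANDIDATE v2 text of the WINDOW+LAW stub for the registered typing of record (D24-3): `stub_cellLawV` with `SectorialIntervalWindowFamily`.
Sorried ONLY to show it elaborates; not registered.  (For K1L_D the skeleton instantiates `W`; the text is word-generic.) -/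
theorem stub_cellLawW_IS : ∀ k (W : Literature.Analysis.FluidPDE.LatticeShear.LatticeWord k) (c₀ : ℝ), 0 < c₀ →
    Literature.Analysis.FluidPDE.LatticeShear.IsotropicWordGain W c₀ → ScalarLawBlock W c₀ →
    ∃ M : ℝ, ∃ hM : 0 < M, ∃ c > (0:ℝ), ∃ Φ : ℝ → Torus.Visc4 (Fin 3) → Torus.Visc4 (Fin 3), ∃ μ : ℝ → ℝ,
      ∃ Sstar : Torus.Visc4 (Fin 3), ∃ slo shi lam₀ Λ Λc Λ' τlo τhi τc : ℝ,
      ∃ lo > (0:ℝ), ∃ hi : ℝ, lo ≤ 1 ∧ 1 ≤ hi ∧ ∃ ΛV > (1:ℝ), ∃ β ≥ (0:ℝ),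
      SectorialIntervalWindowFamily Φ μ Sstar slo shi lam₀ Λ Λc Λ' τlo τhi τc β lo hi ΛV ∧
      ∃ σ > (0:ℝ), ∃ C : ℝ, 0 ≤ C ∧ ∃ ν₀ > (0:ℝ), ∃ K > (0:ℝ), SlowVectorClauseNoExF W M hM c Φ lo hi ΛV β σ C ν₀ K := by
  sorry

/-- **THE RE-PLUMBED GLUE FOR THE v2 TYPING OF RECORD, PROVED** — `chainLower_of_pieces` (p629119) through `SectorialIntervalWindowFamily`:
base estimate (`stub_baseT` text) + the UNCHANGED window-agnostic `stub_oneLevelL_I` + the data of `stub_cellLawW_IS` / `stub_cellEnergyT` ⟹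
`ChainLower E` on the template; window conjunct and the two image facts by `chainTensorF_nearIsoS` / `chainImage_nearIsoS` (+ `OddSmall.mono`
from `τc·hi` to `β`), existence by `existsL_tensor`, `mstar ↦ max mstar m₁`. -/
theorem chainLower_of_pieces_IS
    (hba : ∀ k (E : LatticeShear.LagrangianLatticeCarrier k), E.LPermissible → E.Regular →
    ∀ (m : ℕ) (𝔸 : Torus.Visc4 (Fin 3)) (lo hi : ℝ), 0 < lo → Torus.NearIso 𝔸 lo hi →
      ∀ (w₀ : VF) (u : ℝ → VF), IsDatum w₀ → TSol E m 𝔸 w₀ u →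
        ∀ᵐ t ∂(volume.restrict (Ioo (1/2 : ℝ) 1)),
          (1 - Real.exp (-(4 * Real.pi ^ 2 * lo))) * Torus.vectorL2Sq w₀ ≤ drop w₀ u t)
    (hone : ∀ k (W : Literature.Analysis.FluidPDE.LatticeShear.LatticeWord k) (M : ℝ) (hM : 0 < M) (c : ℝ), 0 < c →
    ∀ (Φ : ℝ → Torus.Visc4 (Fin 3) → Torus.Visc4 (Fin 3)) (lo hi Λ β σ C ν₀ K Cf νf Kf : ℝ),
      0 < lo → lo ≤ 1 → 1 ≤ hi → 1 < Λ → 0 ≤ β →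
      0 < σ → 0 ≤ C → 0 < ν₀ → 0 < K → SlowVectorClauseF W M hM c Φ lo hi Λ β σ C ν₀ K →
      0 ≤ Cf → 0 < νf → 0 < Kf → CellEnergyClauses W M hM c lo hi Λ β Cf νf Kf →
      ∃ ν₁ > (0:ℝ), ∃ K₁ > (0:ℝ), ∃ Λ₀ : ℕ, ∃ θ₀ > (0:ℝ), ∃ C₁ > (0:ℝ), ∃ σ₁ > (0:ℝ),
        ∀ E : Literature.Analysis.FluidPDE.LatticeShear.LagrangianLatticeCarrier k, E.design = W.stretch M hM → E.gain = c → E.nu0 = ν₁ → E.K = K₁ → E.LPermissible → E.Regular → (∀ m, Λ₀ * E.N m ≤ E.N (m + 1)) → (∀ m, E.N m ^ 2 ≤ E.N (m + 1)) → (∀ m, E.cellVisc (m + 1) * ((E.N (m + 1) : ℝ) / E.N m) ^ (1 / 4 : ℝ) ≤ 1) → (∀ m, E.K * ((E.N (m + 1) : ℝ) / E.N m) ^ (1 / 4 : ℝ) ≤ ((E.N (m + 1) : ℝ) / E.N m) * E.cellVisc (m + 1)) → (∀ m, E.θ (m + 1) * ((E.N (m + 1) : ℝ) / E.N m) ^ (1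 / 16 : ℝ) ≤ θ₀) → (∀ m, ((E.N (m + 1) : ℝ) / E.N m) ^ (1 / 16 : ℝ) * E.physPeriod (m + 1) ≤ E.refresh (m + 1)) →
        ∀ R : ℝ≥0, ∃ mstar : ℕ, ∀ m, mstar ≤ m →
          ∀ S : Torus.Visc4 (Fin 3), Torus.OddSmall S β → Torus.NearIso S lo hi →
            Torus.OddSmall (Φ (E.cellVisc (m + 1)) S) β → Torus.NearIso (Φ (E.cellVisc (m + 1)) S) lo hi →
          ∀ (w₀ : VF), IsDatum w₀ → InClass R w₀ →
          ∀ u v : ℝ → VF, TSol E (m + 1) (E.kbar (m + 1) • S) w₀ u →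
            TSol E m (E.kbar m • renormStep (Φ (E.cellVisc (m + 1))) (E.gain / E.cellVisc (m + 1) ^ 2) S) w₀ v →
            ∀ᵐ t ∂(volume.restrict (Ioo (1/2 : ℝ) 1)),
              (1 - C₁ * ((E.N m : ℝ) / E.N (m + 1)) ^ σ₁) * drop w₀ v t ≤ drop w₀ u t) :
    ∀ k (W : Literature.Analysis.FluidPDE.LatticeShear.LatticeWord k) (M : ℝ) (hM : 0 < M) (c : ℝ), 0 < c →
    ∀ (Φ : ℝ → Torus.Visc4 (Fin 3) → Torus.Visc4 (Fin 3)) (μ : ℝ → ℝ) (Sstar : Torus.Visc4 (Fin 3))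
      (slo shi lam₀ Λ Λc Λ' τlo τhi τc lo hi ΛV β σ C ν₀ K Cf νf Kf : ℝ),
      0 < lo → lo ≤ 1 → 1 ≤ hi → 1 < ΛV → 0 ≤ β → SectorialIntervalWindowFamily Φ μ Sstar slo shi lam₀ Λ Λc Λ' τlo τhi τc β lo hi ΛV →
      0 < σ → 0 ≤ C → 0 < ν₀ → 0 < K → SlowVectorClauseF W M hM c Φ lo hi ΛV β σ C ν₀ K →
      0 ≤ Cf → 0 < νf → 0 < Kf → CellEnergyClauses W M hM c lo hi ΛV β Cf νf Kf →
      ∃ ν₁ > (0:ℝ), ∃ K₁ > (0:ℝ), ∃ Λ₀ : ℕ, ∃ θ₀ > (0:ℝ),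
        ∀ E : Literature.Analysis.FluidPDE.LatticeShear.LagrangianLatticeCarrier k, E.design = W.stretch M hM → E.gain = c → E.nu0 = ν₁ → E.K = K₁ → E.LPermissible → E.Regular → (∀ m, Λ₀ * E.N m ≤ E.N (m + 1)) → (∀ m, E.N m ^ 2 ≤ E.N (m + 1)) → (∀ m, E.cellVisc (m + 1) * ((E.N (m + 1) : ℝ) / E.N m) ^ (1 / 4 : ℝ) ≤ 1) → (∀ m, E.K * ((E.N (m + 1) : ℝ) / E.N m) ^ (1 / 4 : ℝ) ≤ ((E.N (m + 1) : ℝ) / E.N m) * E.cellVisc (m + 1)) → (∀ m, E.θ (m + 1) * ((E.N (m + 1) : ℝ) / E.N m) ^ (1 / 16 : ℝ) ≤ θ₀) → (∀ m, ((E.N (m + 1) : ℝ) / E.N m) ^ (1 / 16 : ℝ) * E.physPeriod (m + 1) ≤ E.refresh (m + 1)) → ChainLower E := by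
  intro k W M hM c hc Φ μ Sstar slo shi lam₀ Λ Λc Λ' τlo τhi τc lo hi ΛV β σ C ν₀ K Cf νf Kf hlo hlo1 hhi1 hΛV hβ hWF hσ hC hν₀ hK hV hCf hνf hKf hEcl
  obtain ⟨ν₁, hν₁, K₁, hK₁, Λ₀, θ₀, hθ₀, C₁, hC₁, σ₁, hσ₁, hlev⟩ :=
    hone k W M hM c hc Φ lo hi ΛV β σ C ν₀ K Cf νf Kf hlo hlo1 hhi1 hΛV hβ hσ hC hν₀ hK hV hCf hνf hKf hEcl
  refine ⟨ν₁, hν₁, K₁, hK₁, Λ₀, θ₀, hθ₀, ?_⟩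
  intro E hW hg hn hK' hP hR h1a h1b h2 h3 h4 h5
  have hlevE := hlev E hW hg hn hK' hP hR h1a h1b h2 h3 h4 h5
  obtain ⟨hwin, hμ, htailB, hslo, hlamc, hΛcΛ, hloc, hhic, _, _, _, hτc, hτc0, hτcβ, _⟩ := hWF
  obtain ⟨m₁, htail⟩ := htailB k E hP h1b h2
  have hhi0 : 0 ≤ hi := zero_le_one.trans hhi1
  have hτhi : 0 ≤ τc * hi := mul_nonneg hτc0 hhi0
  have hwinT : ∀ j m, m₁ ≤ m → m ≤ j → Torus.NearIso (chainTensorF E Φ j m) (E.kbar m * lo) (E.kbar m * hi) :=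
    fun j m hm hmj => (chainTensorF_nearIsoS E hslo.le hτc hτc0 hwin hμ hΛcΛ hlo.le hloc hhic htail hm hmj).2
  refine ⟨lo, hlo, hi, C₁, hC₁, σ₁, hσ₁, ?_⟩
  intro R
  obtain ⟨mstar, hm⟩ := hlevE R
  refine ⟨max mstar m₁, fun j hj => ⟨chainTensorF E Φ j, chainTensorF_top E Φ j,
    fun m hm1 hm2 => hwinT j m ((le_max_right _ _).trans hm1) hm2, ?_⟩⟩
  intro m hm1 hm2 w₀ hdat hcl
  have hm1' : m₁ ≤ m := (le_max_right _ _).trans hm1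
  have hm1'' : mstar ≤ m := (le_max_left _ _).trans hm1
  obtain ⟨⟨hSo, hSn⟩, _⟩ := chainTensorF_nearIsoS E hslo.le hτc hτc0 hwin hμ hΛcΛ hlo.le hloc hhic htail
    (show m₁ ≤ m + 1 by omega) (show m + 1 ≤ j by omega)
  obtain ⟨hΦo, hΦn⟩ := chainImage_nearIsoS E hslo.le hτc hτc0 hwin hμ hΛcΛ hlo.le hloc hhic htail hm1' hm2
  have hstep := hm m hm1'' _ (hSo.mono hτhi hτcβ) hSn (hΦo.mono hτhi hτcβ) hΦn w₀ hdat hcl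
  refine ⟨existsL_tensor E hR m (hwinT j m hm1' hm2.le) (mul_pos (E.kbar_pos m) hlo) w₀ hdat, ?_⟩
  intro u v hu hv
  have hv' := hv
  rw [chainTensorF_succ E Φ hm2] at hv'
  have hu' : TSol E (m + 1) (E.kbar (m + 1) • shapeSeqF (fun i => Φ (E.cellVisc i)) (fun i => E.gain / E.cellVisc i ^ 2) j (j - (m + 1))) w₀ u := hu
  have hcmp := hstep u v hu' hv'
  have hbase := hba k E hP hR m (chainTensorF E Φ j m) (E.kbar m * lo) (E.kbar m * hi)
    (mul_pos (E.kbar_pos m) hlo) (hwinT j m hm1' hm2.le) w₀ v hdat hv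
  have hcb : 0 ≤ 1 - Real.exp (-(4 * Real.pi ^ 2 * (E.kbar m * lo))) := by
    have hexp : Real.exp (-(4 * Real.pi ^ 2 * (E.kbar m * lo))) < 1 := by
      rw [Real.exp_lt_one_iff]
      have : 0 < 4 * Real.pi ^ 2 * (E.kbar m * lo) := by
        have := E.kbar_pos m
        positivity
      linarith
    linarith
  have hL2 : 0 ≤ Torus.vectorL2Sq w₀ := by
    show 0 ≤ ∫ x, ‖w₀ x‖ ^ 2
    exact integral_nonneg fun x => by positivity
  filter_upwards [hcmp, hbase] with t h1 h2
  exact ⟨le_trans (mul_nonneg hcb hL2) h2, h1⟩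

/-! ### p5's W5 in sectorial currency: gain + source ⇒ the odd half of the clause -/

/-- SECTORIAL GAIN-PLUS-SOURCE BOUND (the sector analogue of p5's W5 `OddChannelBound Φ lo hi Λ κ ε`, CellLawVPlanSketch v3): on the interval of
aspect `λ ∈ [λ₀, Λ]` the map shrinks the sector by the factor `κ` up to a source `ε` (numbers of record: `κ ≤ 0.62 < 1` for `DΦ_{W₀}` over aspects
≤ 57; `ε` = the ν-uniform mixing residue in sector units, positive for the non-reversal-symmetric cubature word — p5 12:45:20Z (1)). -/
def SectorialOddChannelBound (Φν : T4 → T4) (Sstar : T4) (lam₀ Λ κ ε : ℝ) : Prop :=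
  ∀ lam ∈ Set.Icc lam₀ Λ, ∀ S : T4, ∀ τ : ℝ, 0 ≤ τ → InInterval Sstar lam S → OddSectorial S τ → OddSectorial (Φν S) (κ * τ + ε)

/-- **The odd half of `SectorialIntervalWindowClause` from gain + source.**  If `κ, ε ≥ 0`, `κ·τ + ε ≤ τ` for `τ ∈ [τlo, τhi]` (for `κ < 1`:
`τlo ≥ ε/(1-κ)`), `τlo ≥ 0`, and the EVEN half holds (it may use the sector hypothesis), then the full clause holds. -/
theorem sectorialIntervalWindowClause_of_channelBound {Φν : T4 → T4} {Sstar : T4} {slo shi lam₀ Λ τlo τhi μ κ ε : ℝ}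
    (hstar : Torus.NearIso Sstar slo shi) (hslo : 0 ≤ slo) (hlam₀ : 1 ≤ lam₀) (hiso : InInterval Sstar lam₀ (Torus.isoVisc 1)) (hμ : 1 ≤ μ)
    (hκ : 0 ≤ κ) (hε : 0 ≤ ε) (hτlo : 0 ≤ τlo) (hfix : ∀ τ ∈ Set.Icc τlo τhi, κ * τ + ε ≤ τ)
    (hodd : SectorialOddChannelBound Φν Sstar lam₀ Λ κ ε)
    (heven : ∀ τ ∈ Set.Icc τlo τhi, ∀ lam ∈ Set.Icc lam₀ Λ, ∀ S : T4, OddSectorial S τ → InInterval Sstar lam S →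
      InInterval Sstar (μ * lam) (Φν S)) :
    SectorialIntervalWindowClause Φν Sstar slo shi lam₀ Λ τlo τhi μ := by
  refine ⟨hstar, hlam₀, hiso, fun τ hτ lam hlam S hSo hSi => ?_⟩
  have hΦi := heven τ hτ lam hlam S hSo hSi
  have hτ0 : 0 ≤ τ := hτlo.trans hτ.1
  have hlam1 : 1 ≤ lam := hlam₀.trans hlam.1
  have hμlam1 : 1 ≤ μ * lam := one_le_mul_of_one_le_of_one_le hμ hlam1
  have hΦnn : TransNonneg (Φν S) :=
    transNonneg_of_nearIso (InInterval.nearIso hμlam1 hstar hΦi) (div_nonneg hslo (zero_le_one.trans hμlam1))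
  have h := hodd lam hlam S τ hτ0 hSi hSo
  exact ⟨h.mono hΦnn (by positivity) (hfix τ hτ), hΦi⟩

/-- The fixed-point inequality of the previous theorem from `0 ≤ κ < 1` and `τlo ≥ ε/(1-κ)` (p5's `β ≥ ε/(1-κ)` in sector units). -/
theorem sector_fix_of_gain_lt_one {κ ε τlo τhi : ℝ} (hκ1 : κ < 1) (hτlo : ε / (1 - κ) ≤ τlo) :
    ∀ τ ∈ Set.Icc τlo τhi, κ * τ + ε ≤ τ := by
  intro τ hτ
  have h1 : 0 < 1 - κ := by linarith
  have h2 : ε ≤ (1 - κ) * τ := by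
    rw [div_le_iff₀ h1] at hτlo
    nlinarith [hτ.1]
  nlinarith


end

end Summit.AnomalousDissipation.AnomalousDissipation.Cruxes.LagrangianRenormalisationStep.IntervalWindowFamily
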